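import Literature.MathematicalPhysics.QuantumFieldTheory.King1986.AveragingWeightRate
import Literature.MathematicalPhysics.QuantumFieldTheory.King1986.TwoSpacingSymbol
import HarnessLib

/-!
# King 1986 p. 673 AS PRINTED, for every Hölder index `0 < γ ≤ 1`: the `γ`-interpolated two-spacing rates
# (4.24), (4.25), (4.26), Lemma 4.4 (4.29) of the averaging weight `u_k^η`, and (4.31) — the "rate against momentum
# powers" trade; (v1.2/v1.3) the two-pair Hölder quotient of the phase (4.27)–(4.28)

**Citation header (reproduction of PUBLISHED work; literature seat `b2b-balaban-t4-lit2` gen 12 of the Bałaban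
lattice Yang–Mills cell `pub-balaban`; record `t4/T4-LIT2-CITABLE-NE.md` v2.16 §8.20; a short corollary file of the
template module `King1986/AveragingWeightRate` (one writer per file: that module is the template lineage's, so the
`γ < 1` forms it announces but does not spell out are filed HERE, importing it and proving everything) and, for §7,
of this lineage's `King1986/TwoSpacingSymbol`.**
C. King, *The U(1) Higgs model. I. The continuum limit*, Commun. Math. Phys. **102** (1986) 649–677 [King1986], §4
p. 673: (4.24), (4.25), (4.26), Lemma 4.4 (4.29) with its proof (4.30), (4.31).  Page image READ AS IMAGE by this
seat (gen 12):
`b2b-balaban-template/king-renders/1986-cmp102-king-u1-higgs-I-p025-x2.png` (p. 673).  King's paper is TEMPLATE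
LITERATURE for the cell (a printed and proved `A = 0` mechanism, abelian Higgs, `d = 2, 3`), not a manuscript under
audit; nothing in this file is about Bałaban's papers.

**What King prints (verbatim, p. 673).**  «First we have |exp[i(p′+l)x] − exp[i(p′+l)x′]| ≤ C|p′+l|^γ|x − x′|^γ
≤ CL^{−γk}|p′+l|^γ. (4.24)  So keeping γ + α < 1, the error produced by the above replacement is bounded by
CL^{−γk}. Next, we have |(η′)^{−1}[exp[iη′(p′+l)_μ] − 1] − η^{−1}[exp[iη(p′+l)_μ] − 1]| ≤ (η′)^{−1}sin²1/2η′(p′+l)_μ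
+ η^{−1}sin²1/2η(p′+l)_μ + |(η′)^{−1}sin η′(p′+l)_μ − η^{−1}sin η(p′+l)_μ| ≤ C|p′+l|²L^{−k} ≤ C|p′+l|^{1+γ}L^{−γk}.
(4.25)» … «**Lemma 4.4.** |u^η_k(p′+l) − u^{η′}_{k+n}(p′+l)| ≤ CL^{−γk}|p′+l|^γ|u^η_k(p′+l)|. (4.29)» (proof
(4.30): «By repeated use of the identity xy − zw = 1/2(x − y)(z + w) + 1/2(x + y)(z − w), we can write the difference
inside the last bracket of (4.30) as a sum of 2^{d−1} terms. Each term is a product of d factors, at least one of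
which is the left-hand side of (4.25). So inserting the appropriate bounds, we get |(4.30)| ≤ C|u^η_k(p′+l)|
Π_{μ=1}^d|(p′+l)_μ|^{−1}L^{−γk} Σ_{ν=1}^d|(p′+l)_ν|^{1+γ} Π_{μ′≠ν}|(p′+l)_{μ′}| ≤ CL^{−γk}|p′+l|^γ|u^η_k(p′+l)|, as
required. Therefore we can replace u^{η′}_{k+n}(p′+l) by u^η_k(p′+l) and bound the error.»).  Here `η = L^{−k}`,
`η′ = L^{−(k+n)}`, `0 < γ < 1` is King's Hölder index (p. 672: (4.22) «≤ C for α < 1», (4.23) «≤ CL^{−γk} for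
α + γ < 1»: the rate `L^{−γk}` is traded against `γ` powers of the alias momentum, which the alias sums must still
absorb — p. 672–673 «We must always be careful to keep enough negative powers of momentum so that the sum over l is
bounded.»).

**What the template already has (kernel, `King1986/AveragingWeightRate`, TEMPLATE §18.2 K3).**  The `γ = 1` forms
with constant: `norm_fdq_sub_fdq_le` (= (4.25) middle inequality, `‖D_{η′}(q) − D_η(q)‖ ≤ |η − η′|·q²`, all real
`q`), `lemma44` / `lemma44_scaling` (= (4.29) at `γ = 1`, `‖u_k − u_{k+n}‖ ≤ (π/2)^{d+1}L^{−k}(Σ_μ|p_μ|)‖u_k‖` on the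
zone `|p_μ| ≤ πL^k`), and the comparability of one factor at two spacings `norm_uFac_le_mul`.  Its header: «The
printed `γ < 1` versions are weaker on the zone … and are not spelled out.»

**What this file PROVES (kernel, Mathlib + the template module; explicit constants; NO named fact).**
* §1 the interpolation step that IS King's `γ` [folklore]: `min(x, 1) ≤ x^γ` for `x ≥ 0`, `0 ≤ γ ≤ 1`
  (`min_one_le_rpow`), and the TRADE LEMMA `le_max_mul_rpow_mul`: a first-order RATE bound `a ≤ A·x·b` together
  with a UNIFORM bound `a ≤ B·b` gives `a ≤ max(A, B)·x^γ·b` for every `0 ≤ γ ≤ 1` — "rate to the power γ at the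
  price of nothing but the constant", the mechanism behind every `L^{−γk}` on pp. 672–675.
* §2 **(4.24), first inequality** (`norm_cexp_sub_cexp_le_rpow`): `‖e^{ia} − e^{ib}‖ ≤ 2·|a − b|^γ` for all real
  `a, b` and `0 ≤ γ ≤ 1`; hence `‖e^{iqx} − e^{iqx′}‖ ≤ 2·|q|^γ·|x − x′|^γ` (`holder_424`) — King's
  «≤ C|p′+l|^γ|x − x′|^γ» with `C = 2`; and the second inequality «≤ CL^{−γk}|p′+l|^γ» as the case
  `|x − x′| ≤ δ` (`holder_424_of_le`, v1.1: `≤ 2·|q|^γ·δ^γ`; King's `δ = L^{−k}`).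
* §3 **(4.25), last inequality, with NO zone condition** (`holder_425`): `‖D_{η′}(q) − D_η(q)‖ ≤
  2·|η − η′|^γ·|q|^{1+γ}` for all `0 < η, η′`, all real `q`, `0 ≤ γ ≤ 1` (rate `|η − η′|·q²` interpolated
  against the uniform `‖D_η(q)‖ ≤ |q|`); in King's scaling `|η − η′| ≤ L^{−k}` this is «≤ C|p′+l|^{1+γ}L^{−γk}»
  with `C = 2` (print reaches it on the zone from `C|p′+l|²L^{−k}`; the interpolation route needs no zone).  At
  `γ = 1` the constant `2` is the price of the trade lemma's `max(A, B)` — the template's direct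
  `norm_fdq_sub_fdq_le` has `1` there (print's `C` is unspecified).  Sign convention: (4.25) prints
  `exp[+iη(p′+l)_μ]`, (4.3)/(4.30) print `e^{−iη(p′+l)_μ}`; the template's `fdq` follows (4.3), and the normed
  statements coincide under complex conjugation.
* §4 comparability of the whole weight at two spacings on the two zones, `‖u^{η′}(p)‖ ≤ (π/2)^d‖u^η(p)‖`
  (`norm_uWeight_le_mul`), hence the UNIFORM two-spacing bound `‖u^η(p) − u^{η′}(p)‖ ≤ (1 + (π/2)^d)‖u^η(p)‖`
  (`norm_uWeight_sub_le_unif`).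
* §5 **Lemma 4.4 (4.29) for every `0 ≤ γ ≤ 1`** (`lemma44_holder`): on the zones `|ηp_μ| ≤ π`, `|η′p_μ| ≤ π`,
  `‖u^η(p) − u^{η′}(p)‖ ≤ ((π/2)^{d+1} + 1)·(|η − η′|·Σ_μ|p_μ|)^γ·‖u^η(p)‖`; in King's scaling
  (`lemma44_holder_scaling`; `η = L^{−k}`, `η′ = L^{−(k+n)}`, zone `|p_μ| ≤ πL^k`):
  `‖u_k − u_{k+n}‖ ≤ ((π/2)^{d+1} + 1)·(L^{−k})^γ·(Σ_μ|p_μ|)^γ·‖u_k‖` — (4.29) with `C = (π/2)^{d+1} + 1`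
  and the ℓ¹ size `Σ_μ|p_μ|` in place of `|p′+l|` (`Σ_μ|p_μ| ≤ √d·|p|₂`, so King's Euclidean form follows with
  `C·d^{γ/2}`).  `γ = 0` is allowed and is the uniform bound; `γ = 1` is the template's `lemma44_scaling` up to
  the constant.
* §6 (v1.1) **(4.26), first inequality** (`holder_426`): for `x ≠ y`, `0 ≤ α, γ`, `α + γ ≤ 1`,
  `|x − y|^{−α}·‖1 − e^{iq(y−x)}‖ ≤ 2·|q|^{α+γ}·|x − y|^γ` — King's «|x − y|^{−α}|1 − exp[i(p′+l)(y − x)]| ≤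
  C|p′+l|^{α+γ}|x − y|^γ» with `C = 2` (the phase's Hölder-(α+γ) continuity divided by `|x − y|^α`; print's
  second inequality «≤ CL^{−γk}|p′+l|^{α+γ}» is the case `|x − y| ≤ L^{−k}`).
* §7 (v1.1) **(4.31), second inequality, on the zone** (`holder_431`): King's «|Δ^{η′}(p′+l)^{−1} −
  Δ^η(p′+l)^{−1}| ≤ CL^{−2k} ≤ CL^{−γk}|p′+l|^{−2+γ}» — the first inequality is the tree's SHARP symbol bound
  `King1986/TwoSpacingSymbol.abs_twoSpacing_unscaled_le` (this lineage, gen 4: `|Δ^η_M(q)⁻¹ − composedInv 0 N R M q|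
  ≤ (π²/24 + 1/3)·N⁻²` for `q ≠ 0`, `|q_μ| ≤ πN`, i.e. `η = N⁻¹ = L^{−k}` against King's composed symbol (4.12)
  without its constant); the second is the ZONE WEAKENING `N^{−2} ≤ N^{−γ}·π^{2−γ}·‖q‖_∞^{γ−2}` (because
  `‖q‖_∞ ≤ πN`), giving `≤ (π²/24 + 1/3)·π^{2−γ}·N^{−γ}·‖q‖_∞^{γ−2}` for every `γ ≤ 2` (sup norm of
  `q : Fin d → ℝ`) — unlike §3, here the trade genuinely needs the zone (it runs against `N ≥ ‖q‖_∞/π`, not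
  against a uniform bound).
* §8 (v1.2) **(4.27)–(4.28), the two-pair statement.**  King: «Furthermore, when |x − y| > L^{−k}, we have
  ||x − y| − |x′ − y′|| ≤ L^{−k}. (4.27) Therefore it follows easily that ||x − y|^{−α}{1 − exp[i(p′+l)(y − x)]}
  − |x′ − y′|^{−α}{1 − exp[i(p′+l)(y′ − x′)]}| ≤ CL^{−γk}|p′+l|^{α+γ}, (4.28) where we have assumed α + γ < 1 and
  γ ≤ α.»  Here `x′, y′` are sites of the fine lattice and `x, y` the sites of the coarse one they are ATTACHED to
  (p. 664, the sentence before Prop. 3.8: «When x′ ∈ T_η′, we denote by x that point in T_η for which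
  x′ ∈ B^n(x).» — a block of diameter `≍ L^{−k}`).  KERNEL, with the attachment typed as what it delivers,
  PROXIMITY `‖x − x′‖ ≤ δ`, `‖y − y′‖ ≤ δ` (print: `δ ≍ L^{−k}`; the convention-dependent constant in (4.27) is
  immaterial): `holder_427` — (4.27) as the reverse triangle inequality `|‖x − y‖ − ‖x′ − y′‖| ≤ ‖x − x′‖ +
  ‖y − y′‖` in any seminormed group; **`holder_428c`** (v1.3) — (4.28) AS PRINTED, i.e. the modulus of the
  DIFFERENCE OF THE TWO COMPLEX NUMBERS (King's braces are grouping, as in (4.26)): in any real inner product space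
  `E` (positions AND momenta in `E`, phase `⟪q, y − x⟫`), for `0 ≤ α`, `0 < γ`, `α + γ ≤ 1`:
  `‖ ‖x − y‖^{−α}·(1 − e^{i⟪q, y−x⟫}) − ‖x′ − y′‖^{−α}·(1 − e^{i⟪q, y′−x′⟫}) ‖ ≤ 12·‖q‖^{α+γ}·δ^γ` — (4.28) with
  `C = 12` at `δ = L^{−k}` (`holder_428c_king`; `holder_428c_sub` the difference form with constant `6`,
  `holder_428c_real` the scalar currency, `holder_428c_core` the normed-space core), for ALL point pairs (print states
  it for |x − y| > L^{−k} because its near pairs are (4.26)'s), WITHOUT «γ ≤ α», and with «α + γ < 1» relaxed to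
  `≤ 1` (strictness is used in print for the alias sums (4.22)–(4.23), not here); and `holder_428` (v1.2) — the
  MODULI form `|‖x − y‖^{−α}‖1 − e^{i⟪q, y−x⟫}‖ − ‖x′ − y′‖^{−α}‖1 − e^{i⟪q, y′−x′⟫}‖| ≤ 12·‖q‖^{α+γ}·δ^γ`, a
  CONSEQUENCE of the printed shape by `|‖A‖ − ‖B‖| ≤ ‖A − B‖` and NOT equivalent to it (v1.2 glossed it as (4.28);
  the cross-read C-ne4p1-39 of t4-ne4-p1-g19 located the gap — witness `x′ = y`, `y′ = x`: moduli difference `0`,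
  complex difference `2‖x − y‖^{−α}|sin⟪q, y − x⟫|` — and v1.3 closes it).  Mechanism (`holder_428c_core` in a
  normed space, `holder_428_core` its real-variable shadow; identical constants): NEAR pairs `‖y − x‖ ≤ ε` — each
  quotient separately `≤ 2‖q‖^{α+γ}·(its own distance)^γ` by §6's mechanism (Hölder-(α+γ) phase over `|·|^α`);
  FAR pairs — cancellation: the phase's Hölder-(α+γ) increment at fixed prefactor (`a^{−α}·2‖q‖^{α+γ}ε^{α+γ} ≤
  2‖q‖^{α+γ}ε^γ` because `a > ε`) plus the prefactor's increment `|a^{−α} − b^{−α}| ≤ min(a,b)^{−α}|a − b|/max(a,b)`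
  (from `t ≤ t^α` on `(0,1]`; a local step of the proof, identical to the tree's
  `Balaban1983to89/B5Hk163RateQuotient.rpow_neg_sub_rpow_neg_le` — not imported: that would invert the
  literature → cell dependency direction) at fixed phase.  This is the SAME organisation as the T⁴ cell's
  function-level ℓ¹ statement `Balaban1983to89/B5Hk163RateQuotient.HQ_perturb_le` (seat t4-ne2-p1, gen 3: any
  (α+γ)-Hölder `f` on `ℝ^d`, constant `6H`), written here PER MODE for King's own phase in Euclidean dress;
  `holder_428_real`/`holder_428c_real` are the scalar currency of `holder_426`.  With §6, §8 and §8b every display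
  of p. 673 is kernel in its printed shape.

**NOT COVERED.**  The alias sums (4.22)–(4.23) (kernel elsewhere: the template's `King1986/AliasSums`), the
`∫dp′` and the assembly of Proposition 3.8 (3.71) with its decay factor, the attachment map `x′ ↦ x` itself (only
the proximity it delivers is a hypothesis of §8), anything at `A ≠ 0`, anything about Bałaban's covariant averaging
or his `G(p′)` of [CMP 95 (1984)] (1.83).  No `def … : Prop` hypothesis is introduced; every statement is proved.

**Versions.**  v1 = p192472 (§§1–5; cross-read pv24-g19, GAPS C-pv24g19-1: ok CONSISTENT, 13/13 «» spans verbatim,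
DOCFIX 0, INFO 5).  v1.1 = v1 + §6 (4.26) + §7 (4.31) + `holder_424_of_le` + the two INFO sentences in the §3
bullet above (constant at `γ = 1`; sign convention); every v1 declaration byte-identical; one new import
(`King1986.TwoSpacingSymbol`, for §7); cross-read pv24-g19 (v1) / adv4-g70 (delta), DOCFIX 0.  v1.2 (gen 14) = v1.1 +
§8 (4.27)–(4.28) (`holder_427`, `norm_cexp_inner_sub_cexp_inner_le`, `norm_one_sub_cexp_inner_le`,
`holder_428_core`, `holder_428_sub`, `holder_428`, `holder_428_king`, `holder_428_real`) + this header's title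
suffix, §8 bullet and NOT COVERED sentence; every v1.1 declaration byte-identical; no new import; cross-read
t4-ne4-p1-g19 (C-ne4p1-39): ok CONSISTENT as a consequence of print, «» 2/2 + 6/6 verbatim, ABSOLUTE-RULE 0, DOCFIX 1
MATERIAL (statement shape: moduli difference instead of print's complex difference).  v1.3 (gen 14, same session) =
v1.2 + §8b (`holder_428c_core`, `holder_428c_sub`, `holder_428c`, `holder_428c_king`, `holder_428c_real`: (4.28) in
its PRINTED complex-difference shape, same constants) + the re-glossing of §8's four moduli docstrings and of this
bullet; every v1.2 declaration byte-identical; no new import.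

**How the cell uses this (pointer, not a ruling).**  Record `t4/T4-LIT2-CITABLE-NE.md` §8.19 (viii) / §8.20: the
T⁴ cell's NE2 leaf `Balaban1983to89/B5G183RateWTheta` TYPES an exponent trade `OrderTwoOpRateResidualWθ d a C θ γ`
(weights `W^θ` on each derivative, rate `N^{−γ}`; «expected … γ(θ) = θ, by interpolating the derivative replacement
cost `6|q̃|²/N` with its uniform bound» — an [analysis] line of that lineage, NOT decided here) and its companions
(`B5G183RateW1BlockC`, `…WgtPieces`) cite «(4.29)–(4.31) p.673» as the printed SHAPE.  This file makes the printed
abelian shape a kernel object for general `γ` and isolates the interpolation step (§1) by name.  Rung (B)+1 literature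
service; NOT summit progress (finite torus T⁴ programme; no infinite volume, no mass gap, not the Clay statement).
-/

noncomputable section

open Complex Finset

namespace Literature.MathematicalPhysics.QuantumFieldTheory.King1986

/-! ## §1 The interpolation step behind King's `γ` -/

/-- `min(x, 1) ≤ x^γ` for `x ≥ 0` and `0 ≤ γ ≤ 1`: below `1` one has `x ≤ x^γ`, above `1` one has `1 ≤ x^γ`.
[folklore] -/
theorem min_one_le_rpow {x γ : ℝ} (hx : 0 ≤ x) (hγ0 : 0 ≤ γ) (hγ1 : γ ≤ 1) : min x 1 ≤ x ^ γ := by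
  rcases le_total x 1 with h | h
  · rw [min_eq_left h]
    exact Real.self_le_rpow_of_le_one hx h hγ1
  · rw [min_eq_right h]
    exact Real.one_le_rpow h hγ0

/-- **The trade lemma.**  A first-order RATE bound `a ≤ A·x·b` and a UNIFORM bound `a ≤ B·b` (`b ≥ 0`, `x ≥ 0`,
`A ≥ 0`) give, for every `0 ≤ γ ≤ 1`, `a ≤ max(A, B)·x^γ·b` — King's passage from `CL^{−k}|p′+l|²` to
`CL^{−γk}|p′+l|^{1+γ}` in (4.25) and from `γ = 1` to `γ < 1` in (4.24), (4.29), (4.31), with the momentum-free part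
of the price made explicit (`max(A, B)`). [folklore] -/
theorem le_max_mul_rpow_mul {a b x A B γ : ℝ} (hb : 0 ≤ b) (hx : 0 ≤ x) (hA : 0 ≤ A)
    (hγ0 : 0 ≤ γ) (hγ1 : γ ≤ 1) (h1 : a ≤ A * x * b) (h2 : a ≤ B * b) :
    a ≤ max A B * x ^ γ * b := by
  have hM : 0 ≤ max A B := le_max_of_le_left hA
  have hmin : a ≤ max A B * min x 1 * b := by
    rcases le_total x 1 with h | h
    · rw [min_eq_left h]
      calc a ≤ A * x * b := h1
        _ ≤ max A B * x * b :=
          mul_le_mul_of_nonneg_right (mul_le_mul_of_nonneg_right (le_max_left A B) hx) hb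
    · rw [min_eq_right h, mul_one]
      calc a ≤ B * b := h2
        _ ≤ max A B * b := mul_le_mul_of_nonneg_right (le_max_right A B) hb
  calc a ≤ max A B * min x 1 * b := hmin
    _ ≤ max A B * x ^ γ * b :=
      mul_le_mul_of_nonneg_right (mul_le_mul_of_nonneg_left (min_one_le_rpow hx hγ0 hγ1) hM) hb

/-! ## §2 (4.24), first inequality: Hölder continuity of the phase -/

/-- `‖e^{ia} − e^{ib}‖ ≤ 2·|a − b|^γ` for all real `a, b` and `0 ≤ γ ≤ 1` (the Lipschitz bound `|a − b|` of the
template's `norm_exp_I_sub_exp_I_le` interpolated against the uniform bound `2`). [cite: King1986, (4.24) p.673] -/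
theorem norm_cexp_sub_cexp_le_rpow (a b : ℝ) {γ : ℝ} (hγ0 : 0 ≤ γ) (hγ1 : γ ≤ 1) :
    ‖Complex.exp (I * (a : ℂ)) - Complex.exp (I * (b : ℂ))‖ ≤ 2 * |a - b| ^ γ := by
  have h1 : ‖Complex.exp (I * (a : ℂ)) - Complex.exp (I * (b : ℂ))‖ ≤ 1 * |a - b| * 1 := by
    simpa using norm_exp_I_sub_exp_I_le a b
  have h2 : ‖Complex.exp (I * (a : ℂ)) - Complex.exp (I * (b : ℂ))‖ ≤ 2 * 1 := by
    calc ‖Complex.exp (I * (a : ℂ)) - Complex.exp (I * (b : ℂ))‖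
        ≤ ‖Complex.exp (I * (a : ℂ))‖ + ‖Complex.exp (I * (b : ℂ))‖ := norm_sub_le _ _
      _ = 2 * 1 := by rw [Complex.norm_exp_I_mul_ofReal, Complex.norm_exp_I_mul_ofReal]; norm_num
  have h := le_max_mul_rpow_mul zero_le_one (abs_nonneg (a - b)) zero_le_one hγ0 hγ1 h1 h2
  have hmax : max (1 : ℝ) 2 = 2 := by norm_num
  simpa [hmax] using h

/-- **(4.24), first inequality, explicit constant.**  For the plane wave of momentum `q` at two points `x, x′`:
`‖e^{iqx} − e^{iqx′}‖ ≤ 2·|q|^γ·|x − x′|^γ` (`0 ≤ γ ≤ 1`) — King's «|exp[i(p′+l)x] − exp[i(p′+l)x′]| ≤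
C|p′+l|^γ|x − x′|^γ» with `C = 2`; the second printed inequality «≤ CL^{−γk}|p′+l|^γ» is the case
`|x − x′| ≤ L^{−k}` (monotonicity of `t ↦ t^γ`). [cite: King1986, (4.24) p.673] -/
theorem holder_424 (q x x' : ℝ) {γ : ℝ} (hγ0 : 0 ≤ γ) (hγ1 : γ ≤ 1) :
    ‖Complex.exp (I * ((q * x : ℝ) : ℂ)) - Complex.exp (I * ((q * x' : ℝ) : ℂ))‖
      ≤ 2 * |q| ^ γ * |x - x'| ^ γ := by
  have h := norm_cexp_sub_cexp_le_rpow (q * x) (q * x') hγ0 hγ1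
  rw [← mul_sub, abs_mul, Real.mul_rpow (abs_nonneg q) (abs_nonneg _), ← mul_assoc] at h
  exact h

/-- **(4.24), second inequality** (v1.1): if the two points are `δ`-close, `|x − x′| ≤ δ`, then
`‖e^{iqx} − e^{iqx′}‖ ≤ 2·|q|^γ·δ^γ` — King's «≤ CL^{−γk}|p′+l|^γ» is `δ = L^{−k}` (a site of the coarse
lattice and the attached site of the fine one). [cite: King1986, (4.24) p.673] -/
theorem holder_424_of_le (q : ℝ) {x x' δ γ : ℝ} (hγ0 : 0 ≤ γ) (hγ1 : γ ≤ 1) (hδ : |x - x'| ≤ δ) :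
    ‖Complex.exp (I * ((q * x : ℝ) : ℂ)) - Complex.exp (I * ((q * x' : ℝ) : ℂ))‖
      ≤ 2 * |q| ^ γ * δ ^ γ := by
  have hmono : |x - x'| ^ γ ≤ δ ^ γ := Real.rpow_le_rpow (abs_nonneg _) hδ hγ0
  calc ‖Complex.exp (I * ((q * x : ℝ) : ℂ)) - Complex.exp (I * ((q * x' : ℝ) : ℂ))‖
      ≤ 2 * |q| ^ γ * |x - x'| ^ γ := holder_424 q x x' hγ0 hγ1
    _ ≤ 2 * |q| ^ γ * δ ^ γ :=
        mul_le_mul_of_nonneg_left hmono (mul_nonneg zero_le_two (Real.rpow_nonneg (abs_nonneg q) _))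

/-! ## §3 (4.25), last inequality: the `γ`-rate of the fine-lattice difference symbol, no zone condition -/

/-- **(4.25) in `γ`-form, all real `q`.**  For `0 < η, η′` and `0 ≤ γ ≤ 1`:
`‖D_{η′}(q) − D_η(q)‖ ≤ 2·|η − η′|^γ·|q|^{1+γ}` (`D_η(q) = η⁻¹(e^{−iηq} − 1)` = the template's `fdq`): the rate
`|η − η′|·q²` (template `norm_fdq_sub_fdq_le`, = print's `C|p′+l|²L^{−k}` with `C = 1`) interpolated against the
uniform bound `‖D_{η′}(q)‖ + ‖D_η(q)‖ ≤ 2|q|` (template `norm_fdq_le`).  In King's scaling `η = L^{−k}`,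
`η′ = L^{−(k+n)}`, `|η − η′| ≤ L^{−k}`, this is print's «≤ C|p′+l|^{1+γ}L^{−γk}» with `C = 2` and without the
zone restriction that print's route (`|p′+l|L^{−k} ≤ C′`) uses. [cite: King1986, (4.25) p.673] -/
theorem holder_425 {η η' : ℝ} (hη : 0 < η) (hη' : 0 < η') (q : ℝ) {γ : ℝ} (hγ0 : 0 ≤ γ) (hγ1 : γ ≤ 1) :
    ‖fdq η' q - fdq η q‖ ≤ 2 * |η - η'| ^ γ * |q| ^ (1 + γ) := by
  have hq := abs_nonneg q
  have h1 : ‖fdq η' q - fdq η q‖ ≤ 1 * (|η - η'| * |q|) * |q| := by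
    calc ‖fdq η' q - fdq η q‖ ≤ |η - η'| * q ^ 2 := norm_fdq_sub_fdq_le hη hη' q
      _ = 1 * (|η - η'| * |q|) * |q| := by rw [← sq_abs q]; ring
  have h2 : ‖fdq η' q - fdq η q‖ ≤ 2 * |q| := by
    calc ‖fdq η' q - fdq η q‖ ≤ ‖fdq η' q‖ + ‖fdq η q‖ := norm_sub_le _ _
      _ ≤ |q| + |q| := add_le_add (norm_fdq_le hη' q) (norm_fdq_le hη q)
      _ = 2 * |q| := by ring
  have h := le_max_mul_rpow_mul hq (mul_nonneg (abs_nonneg _) hq) zero_le_one hγ0 hγ1 h1 h2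
  have hmax : max (1 : ℝ) 2 = 2 := by norm_num
  rw [hmax, Real.mul_rpow (abs_nonneg _) hq] at h
  have hpow : |q| ^ (1 + γ) = |q| * |q| ^ γ := by
    rw [Real.rpow_add' hq (by linarith), Real.rpow_one]
  rw [hpow]
  calc ‖fdq η' q - fdq η q‖ ≤ 2 * (|η - η'| ^ γ * |q| ^ γ) * |q| := h
    _ = 2 * |η - η'| ^ γ * (|q| * |q| ^ γ) := by ring

/-- (4.25) `γ`-form in King's scaling: `η = L^{−k}`, `η′ = L^{−(k+n)}` (`L ≥ 2`), all real `q`: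
`‖D_{η′}(q) − D_η(q)‖ ≤ 2·(L^{−k})^γ·|q|^{1+γ}`. [cite: King1986, (4.25) p.673] -/
theorem holder_425_scaling {L k n : ℕ} (hL : 2 ≤ L) (q : ℝ) {γ : ℝ} (hγ0 : 0 ≤ γ) (hγ1 : γ ≤ 1) :
    ‖fdq (((L : ℝ) ^ (k + n))⁻¹) q - fdq (((L : ℝ) ^ k)⁻¹) q‖
      ≤ 2 * (((L : ℝ) ^ k)⁻¹) ^ γ * |q| ^ (1 + γ) := by
  have hL1 : (1 : ℝ) < L := by exact_mod_cast hL
  have hLk : 0 < (L : ℝ) ^ k := pow_pos (by linarith) k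
  have hLkn : 0 < (L : ℝ) ^ (k + n) := pow_pos (by linarith) (k + n)
  have hη : 0 < ((L : ℝ) ^ k)⁻¹ := inv_pos.mpr hLk
  have hη' : 0 < ((L : ℝ) ^ (k + n))⁻¹ := inv_pos.mpr hLkn
  have hle : ((L : ℝ) ^ (k + n))⁻¹ ≤ ((L : ℝ) ^ k)⁻¹ := by
    apply inv_anti₀ hLk
    rw [pow_add]
    exact le_mul_of_one_le_right hLk.le (one_le_pow₀ hL1.le)
  have hdiff : |((L : ℝ) ^ k)⁻¹ - ((L : ℝ) ^ (k + n))⁻¹| ≤ ((L : ℝ) ^ k)⁻¹ := by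
    rw [abs_of_nonneg (by linarith)]
    linarith [hη'.le]
  have h := holder_425 hη hη' q hγ0 hγ1
  have hmono : |((L : ℝ) ^ k)⁻¹ - ((L : ℝ) ^ (k + n))⁻¹| ^ γ ≤ (((L : ℝ) ^ k)⁻¹) ^ γ :=
    Real.rpow_le_rpow (abs_nonneg _) hdiff hγ0
  have hq : 0 ≤ |q| ^ (1 + γ) := Real.rpow_nonneg (abs_nonneg q) _
  calc ‖fdq (((L : ℝ) ^ (k + n))⁻¹) q - fdq (((L : ℝ) ^ k)⁻¹) q‖
      ≤ 2 * |((L : ℝ) ^ k)⁻¹ - ((L : ℝ) ^ (k + n))⁻¹| ^ γ * |q| ^ (1 + γ) := h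
    _ ≤ 2 * (((L : ℝ) ^ k)⁻¹) ^ γ * |q| ^ (1 + γ) := by gcongr

/-! ## §4 Comparability and the uniform two-spacing bound for the whole weight -/

/-- The weights at two spacings are comparable on the two zones: `‖u^{η′}(p)‖ ≤ (π/2)^d·‖u^η(p)‖`
(product of the template's one-factor comparability `norm_uFac_le_mul`). [folklore] -/
theorem norm_uWeight_le_mul {d : ℕ} {η η' : ℝ} (hη : 0 < η) (hη' : 0 < η') {p : Fin d → ℝ}
    (hp : ∀ μ, |η * p μ| ≤ Real.pi) (hp' : ∀ μ, |η' * p μ| ≤ Real.pi) :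
    ‖uWeight η' p‖ ≤ (Real.pi / 2) ^ d * ‖uWeight η p‖ := by
  rw [norm_uWeight, norm_uWeight]
  calc ∏ μ, ‖uFac η' (p μ)‖ ≤ ∏ μ, (Real.pi / 2 * ‖uFac η (p μ)‖) :=
        Finset.prod_le_prod (fun μ _ => norm_nonneg _) (fun μ _ => norm_uFac_le_mul hη hη' (hp μ) (hp' μ))
    _ = (Real.pi / 2) ^ d * ∏ μ, ‖uFac η (p μ)‖ := by
        rw [Finset.prod_mul_distrib, Finset.prod_const, Finset.card_univ, Fintype.card_fin]

/-- The UNIFORM two-spacing bound (the `γ = 0` endpoint): on the two zones,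
`‖u^η(p) − u^{η′}(p)‖ ≤ (1 + (π/2)^d)·‖u^η(p)‖`. [folklore] -/
theorem norm_uWeight_sub_le_unif {d : ℕ} {η η' : ℝ} (hη : 0 < η) (hη' : 0 < η') {p : Fin d → ℝ}
    (hp : ∀ μ, |η * p μ| ≤ Real.pi) (hp' : ∀ μ, |η' * p μ| ≤ Real.pi) :
    ‖uWeight η p - uWeight η' p‖ ≤ (1 + (Real.pi / 2) ^ d) * ‖uWeight η p‖ := by
  calc ‖uWeight η p - uWeight η' p‖ ≤ ‖uWeight η p‖ + ‖uWeight η' p‖ := norm_sub_le _ _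
    _ ≤ ‖uWeight η p‖ + (Real.pi / 2) ^ d * ‖uWeight η p‖ :=
        add_le_add le_rfl (norm_uWeight_le_mul hη hη' hp hp')
    _ = (1 + (Real.pi / 2) ^ d) * ‖uWeight η p‖ := by ring

/-! ## §5 Lemma 4.4 (4.29) for every Hölder index `0 ≤ γ ≤ 1` -/

/-- **Lemma 4.4 (4.29), general `γ`, explicit constant.**  For `0 < η, η′`, `0 ≤ γ ≤ 1` and `p` in both zones
(`|ηp_μ| ≤ π`, `|η′p_μ| ≤ π`):
`‖u^η(p) − u^{η′}(p)‖ ≤ ((π/2)^{d+1} + 1)·(|η − η′|·Σ_μ|p_μ|)^γ·‖u^η(p)‖`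
— the template's `γ = 1` rate (`lemma44`) interpolated against §4's uniform bound by the trade lemma of §1.
[cite: King1986, Lemma 4.4 (4.29)–(4.30) p.673] -/
theorem lemma44_holder {d : ℕ} {η η' γ : ℝ} (hη : 0 < η) (hη' : 0 < η') (hγ0 : 0 ≤ γ) (hγ1 : γ ≤ 1)
    {p : Fin d → ℝ} (hp : ∀ μ, |η * p μ| ≤ Real.pi) (hp' : ∀ μ, |η' * p μ| ≤ Real.pi) :
    ‖uWeight η p - uWeight η' p‖
      ≤ ((Real.pi / 2) ^ (d + 1) + 1) * (|η - η'| * ∑ μ, |p μ|) ^ γ * ‖uWeight η p‖ := by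
  have hπ : (1 : ℝ) ≤ Real.pi / 2 := by linarith [Real.pi_gt_three]
  have hU := norm_nonneg (uWeight η p)
  have hS : 0 ≤ ∑ μ, |p μ| := Finset.sum_nonneg fun μ _ => abs_nonneg _
  have hx : 0 ≤ |η - η'| * ∑ μ, |p μ| := mul_nonneg (abs_nonneg _) hS
  have hA : 0 ≤ (Real.pi / 2) ^ (d + 1) := by positivity
  -- the γ = 1 rate, rewritten as `A · x · ‖u‖`
  have h1 : ‖uWeight η p - uWeight η' p‖
      ≤ (Real.pi / 2) ^ (d + 1) * (|η - η'| * ∑ μ, |p μ|) * ‖uWeight η p‖ := by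
    have h := lemma44 hη hη' hp hp'
    have hsum : ∑ μ, Real.pi / 2 * |η - η'| * |p μ| = Real.pi / 2 * (|η - η'| * ∑ μ, |p μ|) := by
      rw [Finset.mul_sum, Finset.mul_sum]
      refine Finset.sum_congr rfl fun μ _ => ?_
      ring
    rw [hsum] at h
    calc ‖uWeight η p - uWeight η' p‖
        ≤ (Real.pi / 2) ^ d * (Real.pi / 2 * (|η - η'| * ∑ μ, |p μ|)) * ‖uWeight η p‖ := h
      _ = (Real.pi / 2) ^ (d + 1) * (|η - η'| * ∑ μ, |p μ|) * ‖uWeight η p‖ := by ring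
  -- the uniform bound `B · ‖u‖`
  have h2 := norm_uWeight_sub_le_unif hη hη' hp hp'
  have h := le_max_mul_rpow_mul hU hx hA hγ0 hγ1 h1 h2
  -- `max(A, B) ≤ (π/2)^{d+1} + 1`
  have hmax : max ((Real.pi / 2) ^ (d + 1)) (1 + (Real.pi / 2) ^ d) ≤ (Real.pi / 2) ^ (d + 1) + 1 := by
    refine max_le (by linarith) ?_
    have : (Real.pi / 2) ^ d ≤ (Real.pi / 2) ^ (d + 1) := by
      rw [pow_succ]
      exact le_mul_of_one_le_right (by positivity) hπ
    linarith
  calc ‖uWeight η p - uWeight η' p‖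
      ≤ max ((Real.pi / 2) ^ (d + 1)) (1 + (Real.pi / 2) ^ d) * (|η - η'| * ∑ μ, |p μ|) ^ γ
          * ‖uWeight η p‖ := h
    _ ≤ ((Real.pi / 2) ^ (d + 1) + 1) * (|η - η'| * ∑ μ, |p μ|) ^ γ * ‖uWeight η p‖ := by
        have hxg : 0 ≤ (|η - η'| * ∑ μ, |p μ|) ^ γ := Real.rpow_nonneg hx _
        gcongr

/-- **(4.29) for every `0 ≤ γ ≤ 1` in King's scaling.**  `η = L^{−k}`, `η′ = L^{−(k+n)}` (`L ≥ 2`), zone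
`|p_μ| ≤ πL^k`:  `‖u_k(p) − u_{k+n}(p)‖ ≤ ((π/2)^{d+1} + 1)·(L^{−k})^γ·(Σ_μ|p_μ|)^γ·‖u_k(p)‖` — print's
«|u^η_k(p′+l) − u^{η′}_{k+n}(p′+l)| ≤ CL^{−γk}|p′+l|^γ|u^η_k(p′+l)|» with `C = (π/2)^{d+1} + 1` and the ℓ¹ size
`Σ_μ|p_μ|` of the alias momentum `p = p′ + l`. [cite: King1986, Lemma 4.4 (4.29) p.673] -/
theorem lemma44_holder_scaling {d L k n : ℕ} (hL : 2 ≤ L) {γ : ℝ} (hγ0 : 0 ≤ γ) (hγ1 : γ ≤ 1)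
    {p : Fin d → ℝ} (hp : ∀ μ, |p μ| ≤ Real.pi * (L : ℝ) ^ k) :
    ‖uWeight (((L : ℝ) ^ k)⁻¹) p - uWeight (((L : ℝ) ^ (k + n))⁻¹) p‖
      ≤ ((Real.pi / 2) ^ (d + 1) + 1) * (((L : ℝ) ^ k)⁻¹) ^ γ * (∑ μ, |p μ|) ^ γ
          * ‖uWeight (((L : ℝ) ^ k)⁻¹) p‖ := by
  have hL1 : (1 : ℝ) < L := by exact_mod_cast hL
  have hLk : 0 < (L : ℝ) ^ k := pow_pos (by linarith) k
  have hLkn : 0 < (L : ℝ) ^ (k + n) := pow_pos (by linarith) (k + n)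
  have hη : 0 < ((L : ℝ) ^ k)⁻¹ := inv_pos.mpr hLk
  have hη' : 0 < ((L : ℝ) ^ (k + n))⁻¹ := inv_pos.mpr hLkn
  have hle : ((L : ℝ) ^ (k + n))⁻¹ ≤ ((L : ℝ) ^ k)⁻¹ := by
    apply inv_anti₀ hLk
    rw [pow_add]
    exact le_mul_of_one_le_right hLk.le (one_le_pow₀ hL1.le)
  have hzone : ∀ μ, |((L : ℝ) ^ k)⁻¹ * p μ| ≤ Real.pi := by
    intro μ
    rw [abs_mul, abs_of_pos hη, inv_mul_le_iff₀ hLk]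
    calc |p μ| ≤ Real.pi * (L : ℝ) ^ k := hp μ
      _ = (L : ℝ) ^ k * Real.pi := mul_comm _ _
  have hzone' : ∀ μ, |((L : ℝ) ^ (k + n))⁻¹ * p μ| ≤ Real.pi := by
    intro μ
    rw [abs_mul, abs_of_pos hη']
    calc ((L : ℝ) ^ (k + n))⁻¹ * |p μ| ≤ ((L : ℝ) ^ k)⁻¹ * |p μ| :=
          mul_le_mul_of_nonneg_right hle (abs_nonneg _)
      _ = |((L : ℝ) ^ k)⁻¹ * p μ| := by rw [abs_mul, abs_of_pos hη]
      _ ≤ Real.pi := hzone μ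
  have h := lemma44_holder hη hη' hγ0 hγ1 hzone hzone'
  have hS : 0 ≤ ∑ μ, |p μ| := Finset.sum_nonneg fun μ _ => abs_nonneg _
  have hdiff : |((L : ℝ) ^ k)⁻¹ - ((L : ℝ) ^ (k + n))⁻¹| ≤ ((L : ℝ) ^ k)⁻¹ := by
    rw [abs_of_nonneg (by linarith)]
    linarith [hη'.le]
  have hmono : (|((L : ℝ) ^ k)⁻¹ - ((L : ℝ) ^ (k + n))⁻¹| * ∑ μ, |p μ|) ^ γ
      ≤ (((L : ℝ) ^ k)⁻¹) ^ γ * (∑ μ, |p μ|) ^ γ := by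
    rw [← Real.mul_rpow hη.le hS]
    exact Real.rpow_le_rpow (mul_nonneg (abs_nonneg _) hS) (mul_le_mul_of_nonneg_right hdiff hS) hγ0
  have hU := norm_nonneg (uWeight (((L : ℝ) ^ k)⁻¹) p)
  have hC : 0 ≤ (Real.pi / 2) ^ (d + 1) + 1 := by positivity
  calc ‖uWeight (((L : ℝ) ^ k)⁻¹) p - uWeight (((L : ℝ) ^ (k + n))⁻¹) p‖
      ≤ ((Real.pi / 2) ^ (d + 1) + 1) * (|((L : ℝ) ^ k)⁻¹ - ((L : ℝ) ^ (k + n))⁻¹| * ∑ μ, |p μ|) ^ γ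
          * ‖uWeight (((L : ℝ) ^ k)⁻¹) p‖ := h
    _ ≤ ((Real.pi / 2) ^ (d + 1) + 1) * ((((L : ℝ) ^ k)⁻¹) ^ γ * (∑ μ, |p μ|) ^ γ)
          * ‖uWeight (((L : ℝ) ^ k)⁻¹) p‖ := by gcongr
    _ = ((Real.pi / 2) ^ (d + 1) + 1) * (((L : ℝ) ^ k)⁻¹) ^ γ * (∑ μ, |p μ|) ^ γ
          * ‖uWeight (((L : ℝ) ^ k)⁻¹) p‖ := by ring

/-- The two endpoints by name: at `γ = 1` the general statement is the template's rate up to the constant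
(`(π/2)^{d+1} ≤ (π/2)^{d+1} + 1`), at `γ = 0` it is §4's uniform bound (`x^0 = 1`).  Recorded as the sanity
check that `lemma44_holder` interpolates between two kernel facts and asserts nothing new at the endpoints.
[folklore] -/
theorem lemma44_holder_zero {d : ℕ} {η η' : ℝ} (hη : 0 < η) (hη' : 0 < η') {p : Fin d → ℝ}
    (hp : ∀ μ, |η * p μ| ≤ Real.pi) (hp' : ∀ μ, |η' * p μ| ≤ Real.pi) :
    ‖uWeight η p - uWeight η' p‖ ≤ ((Real.pi / 2) ^ (d + 1) + 1) * ‖uWeight η p‖ := by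
  have h := lemma44_holder hη hη' le_rfl zero_le_one hp hp'
  rw [Real.rpow_zero, mul_one] at h
  exact h

/-! ## §6 (4.26), first inequality: the Hölder quotient of the phase -/

/-- **(4.26), first inequality, explicit constant.**  For `x ≠ y`, `0 ≤ α`, `0 ≤ γ`, `α + γ ≤ 1` and any
momentum `q`: `|x − y|^{−α}·‖1 − e^{iq(y−x)}‖ ≤ 2·|q|^{α+γ}·|x − y|^γ` — King's «|x − y|^{−α}|1 − exp[i(p′+l)
(y − x)]| ≤ C|p′+l|^{α+γ}|x − y|^γ» with `C = 2` (the phase's Hölder-(α+γ) continuity of §2, divided by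
`|x − y|^α`); print's second inequality «≤ CL^{−γk}|p′+l|^{α+γ}» is the case `|x − y| ≤ L^{−k}`.
[cite: King1986, (4.26) p.673] -/
theorem holder_426 (q x y : ℝ) {α γ : ℝ} (hα : 0 ≤ α) (hγ : 0 ≤ γ) (hαγ : α + γ ≤ 1) (hxy : x ≠ y) :
    |x - y| ^ (-α) * ‖1 - Complex.exp (I * ((q * (y - x) : ℝ) : ℂ))‖
      ≤ 2 * |q| ^ (α + γ) * |x - y| ^ γ := by
  have hpos : 0 < |x - y| := abs_pos.mpr (sub_ne_zero.mpr hxy)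
  have h1 : ‖1 - Complex.exp (I * ((q * (y - x) : ℝ) : ℂ))‖ ≤ 2 * |q * (y - x)| ^ (α + γ) := by
    have h := norm_cexp_sub_cexp_le_rpow 0 (q * (y - x)) (by positivity) hαγ
    simpa using h
  have h2 : |q * (y - x)| ^ (α + γ) = |q| ^ (α + γ) * (|x - y| ^ α * |x - y| ^ γ) := by
    rw [abs_mul, abs_sub_comm y x, Real.mul_rpow (abs_nonneg q) (abs_nonneg _), Real.rpow_add hpos]
  rw [h2] at h1
  have hn : 0 ≤ |x - y| ^ (-α) := Real.rpow_nonneg hpos.le _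
  calc |x - y| ^ (-α) * ‖1 - Complex.exp (I * ((q * (y - x) : ℝ) : ℂ))‖
      ≤ |x - y| ^ (-α) * (2 * (|q| ^ (α + γ) * (|x - y| ^ α * |x - y| ^ γ))) :=
        mul_le_mul_of_nonneg_left h1 hn
    _ = 2 * |q| ^ (α + γ) * |x - y| ^ γ * (|x - y| ^ (-α) * |x - y| ^ α) := by ring
    _ = 2 * |q| ^ (α + γ) * |x - y| ^ γ := by
        rw [← Real.rpow_add hpos, neg_add_cancel, Real.rpow_zero, mul_one]

/-! ## §7 (4.31), second inequality: the inverse symbol's sharp rate traded against `2 − γ` momentum powers -/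

/-- **(4.31) in `γ`-form on the zone.**  King: «Finally, from (4.7) |Δ^{η′}(p′+l)^{−1} − Δ^η(p′+l)^{−1}| ≤
CL^{−2k} ≤ CL^{−γk}|p′+l|^{−2+γ}. (4.31)».  The first inequality (the SHARP `η²` two-spacing symbol bound of
the flat scalar free propagator against King's composed symbol (4.12) without its constant) is the tree's
`King1986/TwoSpacingSymbol.abs_twoSpacing_unscaled_le` (constant `π²/24 + 1/3`, this lineage gen 4); the second
is the ZONE WEAKENING: on `|q_μ| ≤ πN` one has `N ≥ ‖q‖_∞/π`, hence `N^{−2} = N^{−γ}·N^{−(2−γ)} ≤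
N^{−γ}·π^{2−γ}·‖q‖_∞^{γ−2}` for every `γ ≤ 2` (sup norm `‖q‖` of `q : Fin d → ℝ`; `q ≠ 0`).  In King's units
`η = N⁻¹ = L^{−k}`: `|Δ^η_M(q)⁻¹ − composedInv 0 N R M q| ≤ (π²/24 + 1/3)·π^{2−γ}·N^{−γ}·‖q‖_∞^{γ−2}` —
«≤ CL^{−γk}|p′+l|^{−2+γ}» with `C = (π²/24 + 1/3)·π^{2−γ}`.  Nothing here is about Bałaban's `G(p′)`.
[cite: King1986, (4.31) p.673; (4.7) p.671] -/
theorem holder_431 {dd N R : ℕ} (hN : 1 ≤ N) [NeZero R] (hR : 1 ≤ R) {M : ℝ} (hM : 0 ≤ M)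
    {q : Fin dd → ℝ} (hq : ∀ μ, |q μ| ≤ Real.pi * N) (hq0 : 0 < momSq q) {γ : ℝ} (hγ2 : γ ≤ 2) :
    |(latticeSymbol ((N : ℝ)⁻¹) M q)⁻¹ - composedInv 0 N R M q|
      ≤ (Real.pi ^ 2 / 24 + 1 / 3) * Real.pi ^ (2 - γ) * ((N : ℝ) ^ γ)⁻¹ * ‖q‖ ^ (γ - 2) := by
  have h := abs_twoSpacing_unscaled_le hN hR hM hq hq0
  have hn : (0 : ℝ) < N := by exact_mod_cast Nat.lt_of_lt_of_le Nat.zero_lt_one hN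
  have hπ := Real.pi_pos
  have hq_ne : q ≠ 0 := by
    rintro rfl
    simp [momSq] at hq0
  have hqn : 0 < ‖q‖ := norm_pos_iff.mpr hq_ne
  have hqle : ‖q‖ ≤ Real.pi * N := by
    refine (pi_norm_le_iff_of_nonneg (by positivity)).mpr fun μ => ?_
    rw [Real.norm_eq_abs]
    exact hq μ
  have hs : 0 ≤ 2 - γ := by linarith
  have h1 : (‖q‖ / Real.pi) ^ (2 - γ) ≤ (N : ℝ) ^ (2 - γ) :=
    Real.rpow_le_rpow (by positivity) (by rw [div_le_iff₀ hπ]; linarith [hqle]) hs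
  have h1pos : 0 < (‖q‖ / Real.pi) ^ (2 - γ) := Real.rpow_pos_of_pos (by positivity) _
  have h2 : ((N : ℝ) ^ (2 - γ))⁻¹ ≤ ((‖q‖ / Real.pi) ^ (2 - γ))⁻¹ := inv_anti₀ h1pos h1
  have h3 : ((‖q‖ / Real.pi) ^ (2 - γ))⁻¹ = Real.pi ^ (2 - γ) * ‖q‖ ^ (γ - 2) := by
    rw [Real.div_rpow hqn.le hπ.le, inv_div, div_eq_mul_inv, ← Real.rpow_neg hqn.le, neg_sub]
  have h4 : ((N : ℝ) ^ 2)⁻¹ = ((N : ℝ) ^ γ)⁻¹ * ((N : ℝ) ^ (2 - γ))⁻¹ := by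
    rw [← mul_inv, ← Real.rpow_add hn, show γ + (2 - γ) = ((2 : ℕ) : ℝ) by push_cast; ring,
      Real.rpow_natCast]
  have hC : 0 ≤ Real.pi ^ 2 / 24 + 1 / 3 := by positivity
  have hNg : 0 ≤ ((N : ℝ) ^ γ)⁻¹ := inv_nonneg.mpr (Real.rpow_nonneg hn.le _)
  calc |(latticeSymbol ((N : ℝ)⁻¹) M q)⁻¹ - composedInv 0 N R M q|
      ≤ (Real.pi ^ 2 / 24 + 1 / 3) * ((N : ℝ) ^ 2)⁻¹ := h
    _ = (Real.pi ^ 2 / 24 + 1 / 3) * (((N : ℝ) ^ γ)⁻¹ * ((N : ℝ) ^ (2 - γ))⁻¹) := by rw [h4]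
    _ ≤ (Real.pi ^ 2 / 24 + 1 / 3) * (((N : ℝ) ^ γ)⁻¹ * (Real.pi ^ (2 - γ) * ‖q‖ ^ (γ - 2))) := by
        rw [← h3]
        exact mul_le_mul_of_nonneg_left (mul_le_mul_of_nonneg_left h2 hNg) hC
    _ = (Real.pi ^ 2 / 24 + 1 / 3) * Real.pi ^ (2 - γ) * ((N : ℝ) ^ γ)⁻¹ * ‖q‖ ^ (γ - 2) := by ring

/-! ## §8 (v1.2) (4.27)–(4.28): the Hölder quotient of the phase at the attached point pairs of two lattices

King, p. 673: «Furthermore, when |x − y| > L^{−k}, we have ||x − y| − |x′ − y′|| ≤ L^{−k}. (4.27) Therefore it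
follows easily that ||x − y|^{−α}{1 − exp[i(p′+l)(y − x)]} − |x′ − y′|^{−α}{1 − exp[i(p′+l)(y′ − x′)]}| ≤
CL^{−γk}|p′+l|^{α+γ}, (4.28) where we have assumed α + γ < 1 and γ ≤ α.»  The primed sites live on the fine
lattice `T_η′`, the unprimed ones are the coarse sites they are attached to (p. 664, before Prop. 3.8: «When
x′ ∈ T_η′, we denote by x that point in T_η for which x′ ∈ B^n(x).»).  What the attachment DELIVERS — proximity
`‖x − x′‖ ≤ δ`, `‖y − y′‖ ≤ δ` with `δ ≍ L^{−k}` — is the hypothesis below; the map `x′ ↦ x` itself is not typed.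
Positions and momenta are taken in an arbitrary real inner product space `E` (King: `ℝ^d`, `d = 2, 3`, Euclidean
`|x − y|`, phase `(p′+l)·(y − x)`); `holder_428_real` is the scalar currency of `holder_426`.  This section's
`holder_428*` bound the difference of the MODULI of the two Hölder quotients; print's (4.28) is the modulus of their
COMPLEX difference — §8b (v1.3) proves that shape (`holder_428c*`) with the same constants. -/

open scoped InnerProductSpace

/-- **(4.27) as the reverse triangle inequality.**  In any seminormed group, `|‖x − y‖ − ‖x′ − y′‖| ≤ ‖x − x′‖ +
‖y − y′‖`; with the attachment of p. 664 (each primed site within `δ ≍ L^{−k}` of its unprimed one) the right side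
is `≤ 2δ` — King's «||x − y| − |x′ − y′|| ≤ L^{−k}» up to the convention-dependent constant, which is immaterial in
(4.28).  [cite: King1986, (4.27) p.673] -/
theorem holder_427 {F : Type*} [SeminormedAddCommGroup F] (x y x' y' : F) :
    |‖x - y‖ - ‖x' - y'‖| ≤ ‖x - x'‖ + ‖y - y'‖ := by
  have h := abs_norm_sub_norm_le (x - y) (x' - y')
  have h2 : ‖(x - y) - (x' - y')‖ ≤ ‖x - x'‖ + ‖y - y'‖ := by
    have : (x - y) - (x' - y') = (x - x') - (y - y') := by abel
    rw [this]
    exact norm_sub_le _ _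
  exact h.trans h2

variable {E : Type*} [NormedAddCommGroup E] [InnerProductSpace ℝ E]

/-- Hölder continuity of the plane-wave phase in the position variable, exponent `s ∈ [0, 1]`, constant `2‖q‖^s`:
`‖e^{i⟪q,u⟫} − e^{i⟪q,v⟫}‖ ≤ 2·‖q‖^s·‖u − v‖^s` (§2's `norm_cexp_sub_cexp_le_rpow` and Cauchy–Schwarz) — the
`E`-valued form of (4.24)'s first inequality. [cite: King1986, (4.24) p.673] -/
theorem norm_cexp_inner_sub_cexp_inner_le (q u v : E) {s : ℝ} (hs0 : 0 ≤ s) (hs1 : s ≤ 1) :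
    ‖Complex.exp (I * ((⟪q, u⟫_ℝ : ℝ) : ℂ)) - Complex.exp (I * ((⟪q, v⟫_ℝ : ℝ) : ℂ))‖
      ≤ 2 * ‖q‖ ^ s * ‖u - v‖ ^ s := by
  have h := norm_cexp_sub_cexp_le_rpow (⟪q, u⟫_ℝ) (⟪q, v⟫_ℝ) hs0 hs1
  have hcs : |⟪q, u⟫_ℝ - ⟪q, v⟫_ℝ| ≤ ‖q‖ * ‖u - v‖ := by
    rw [← inner_sub_right]
    exact (abs_real_inner_le_norm q (u - v))
  have hmono : |⟪q, u⟫_ℝ - ⟪q, v⟫_ℝ| ^ s ≤ (‖q‖ * ‖u - v‖) ^ s :=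
    Real.rpow_le_rpow (abs_nonneg _) hcs hs0
  rw [Real.mul_rpow (norm_nonneg q) (norm_nonneg _)] at hmono
  calc ‖Complex.exp (I * ((⟪q, u⟫_ℝ : ℝ) : ℂ)) - Complex.exp (I * ((⟪q, v⟫_ℝ : ℝ) : ℂ))‖
      ≤ 2 * |⟪q, u⟫_ℝ - ⟪q, v⟫_ℝ| ^ s := h
    _ ≤ 2 * (‖q‖ ^ s * ‖u - v‖ ^ s) := mul_le_mul_of_nonneg_left hmono zero_le_two
    _ = 2 * ‖q‖ ^ s * ‖u - v‖ ^ s := by ring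

/-- The phase factor of the Hölder quotient: `‖1 − e^{i⟪q,v⟫}‖ ≤ 2·‖q‖^s·‖v‖^s` for `s ∈ [0, 1]` (the previous
lemma at `u = 0`). [cite: King1986, (4.26) p.673] -/
theorem norm_one_sub_cexp_inner_le (q v : E) {s : ℝ} (hs0 : 0 ≤ s) (hs1 : s ≤ 1) :
    ‖1 - Complex.exp (I * ((⟪q, v⟫_ℝ : ℝ) : ℂ))‖ ≤ 2 * ‖q‖ ^ s * ‖v‖ ^ s := by
  have h := norm_cexp_inner_sub_cexp_inner_le q (0 : E) v hs0 hs1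
  simpa using h

/-- **The real-variable core of (4.28).**  Distances `a, b ≥ 0` with `|a − b| ≤ ε`, phase factors `0 ≤ P ≤ H·a^{α+γ}`,
`0 ≤ P′ ≤ H·b^{α+γ}` with `|P − P′| ≤ H·ε^{α+γ}` (`H ≥ 0`, `0 ≤ α`, `0 < γ`, `α + γ ≤ 1`, `ε > 0`): then
`|a^{−α}P − b^{−α}P′| ≤ 3·H·ε^γ`.  NEAR (`a ≤ ε`, so `b ≤ 2ε`): `a^{−α}P ≤ H·a^γ ≤ H·ε^γ` and `b^{−α}P′ ≤ H·(2ε)^γ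
≤ 2H·ε^γ`.  FAR (`a > ε`, so `a, b > 0`): `a^{−α}P − b^{−α}P′ = a^{−α}(P − P′) + (a^{−α} − b^{−α})P′`; the first
piece is `≤ ε^{−α}·H·ε^{α+γ} = H·ε^γ`, the second `≤ H·ε·a^{γ−1} ≤ H·ε^γ` by the prefactor's increment
`b^{−α} − a^{−α} ≤ b^{−α}(a − b)/a` (`0 < b ≤ a`; a local step, = the tree's `B5Hk163RateQuotient.rpow_neg_sub_rpow_neg_le`)
in the two orders of `a, b`.  (Mathlib's `0^{−α} = 0` for `α ≠ 0` makes the degenerate pair `a = 0` harmless: then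
`P = 0`.) [folklore] -/
theorem holder_428_core {a b P P' H ε α γ : ℝ} (hα : 0 ≤ α) (hγ : 0 < γ) (hαγ : α + γ ≤ 1)
    (hε : 0 < ε) (hH : 0 ≤ H) (ha : 0 ≤ a) (hb : 0 ≤ b) (hab : |a - b| ≤ ε)
    (hP0 : 0 ≤ P) (hP : P ≤ H * a ^ (α + γ)) (hP'0 : 0 ≤ P') (hP' : P' ≤ H * b ^ (α + γ))
    (hPP : |P - P'| ≤ H * ε ^ (α + γ)) :
    |a ^ (-α) * P - b ^ (-α) * P'| ≤ 3 * H * ε ^ γ := by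
  set s := α + γ with hs_def
  have hs0 : 0 < s := by rw [hs_def]; linarith
  have hγ1 : γ ≤ 1 := by linarith
  have hεγ : 0 ≤ ε ^ γ := Real.rpow_nonneg hε.le _
  have hab1 : a - b ≤ ε := (le_abs_self _).trans hab
  have hab2 : b - a ≤ ε := by rw [abs_sub_comm] at hab; exact (le_abs_self _).trans hab
  -- the prefactor's increment between `0 < b' ≤ a'`: `b'^{-α} − a'^{-α} ≤ b'^{-α}(a' − b')/a'`, from
  -- `b'/a' ≤ (b'/a')^α` on `(0,1]` — this is the tree's `B5Hk163RateQuotient.rpow_neg_sub_rpow_neg_le` (seat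
  -- t4-ne2-p1, gen 3), re-derived as a local step: importing that cell-side module into this King-side file would
  -- invert the literature → cell dependency direction (its closure is 47 Literature modules)
  have prefac : ∀ {a' b' : ℝ}, 0 < b' → b' ≤ a' → b' ^ (-α) - a' ^ (-α) ≤ b' ^ (-α) * (a' - b') / a' := by
    intro a' b' hb' hba'
    have ha' : 0 < a' := hb'.trans_le hba'
    have ht0 : 0 < b' / a' := div_pos hb' ha'
    have ht1 : b' / a' ≤ 1 := (div_le_one ha').mpr hba'
    have hkey : a' ^ (-α) = b' ^ (-α) * (b' / a') ^ α := by
      rw [Real.div_rpow hb'.le ha'.le, Real.rpow_neg hb'.le, Real.rpow_neg ha'.le]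
      have hbα : b' ^ α ≠ 0 := (Real.rpow_pos_of_pos hb' α).ne'
      field_simp
    have hmono : b' / a' ≤ (b' / a') ^ α := by
      have h := Real.rpow_le_rpow_of_exponent_ge ht0 ht1 (by linarith : α ≤ 1)
      rwa [Real.rpow_one] at h
    have hb0 : 0 ≤ b' ^ (-α) := Real.rpow_nonneg hb'.le _
    rw [hkey]
    calc b' ^ (-α) - b' ^ (-α) * (b' / a') ^ α = b' ^ (-α) * (1 - (b' / a') ^ α) := by ring
      _ ≤ b' ^ (-α) * (1 - b' / a') := mul_le_mul_of_nonneg_left (by linarith) hb0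
      _ = b' ^ (-α) * (a' - b') / a' := by field_simp
  -- the Hölder quotient of one pair: `t^{-α} R ≤ H t^γ` whenever `0 ≤ R ≤ H t^s`
  have key : ∀ {t R : ℝ}, 0 ≤ t → 0 ≤ R → R ≤ H * t ^ s → t ^ (-α) * R ≤ H * t ^ γ := by
    intro t R ht hR hRle
    rcases ht.eq_or_lt with h0 | htpos
    · -- t = 0: then R ≤ H * 0 = 0
      rw [← h0] at hRle ⊢
      rw [Real.zero_rpow hs0.ne', mul_zero] at hRle
      have hR0 : R = 0 := le_antisymm hRle hR
      rw [hR0, mul_zero, Real.zero_rpow hγ.ne', mul_zero]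
    · calc t ^ (-α) * R ≤ t ^ (-α) * (H * t ^ s) :=
            mul_le_mul_of_nonneg_left hRle (Real.rpow_nonneg ht _)
        _ = H * (t ^ (-α) * t ^ s) := by ring
        _ = H * t ^ γ := by rw [← Real.rpow_add htpos]; congr 1; rw [hs_def]; ring_nf
  have hX0 : 0 ≤ a ^ (-α) * P := mul_nonneg (Real.rpow_nonneg ha _) hP0
  have hY0 : 0 ≤ b ^ (-α) * P' := mul_nonneg (Real.rpow_nonneg hb _) hP'0
  have hXle : a ^ (-α) * P ≤ H * a ^ γ := key ha hP0 hP
  have hYle : b ^ (-α) * P' ≤ H * b ^ γ := key hb hP'0 hP'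
  have h2γ : (2 : ℝ) ^ γ ≤ 2 := by
    have h := Real.rpow_le_rpow_of_exponent_le (by norm_num : (1 : ℝ) ≤ 2) hγ1
    rwa [Real.rpow_one] at h
  by_cases hnear : a ≤ ε
  · -- NEAR case: both quotients are small separately
    have h1 : a ^ (-α) * P ≤ H * ε ^ γ :=
      hXle.trans (mul_le_mul_of_nonneg_left (Real.rpow_le_rpow ha hnear hγ.le) hH)
    have hb2 : b ≤ 2 * ε := by linarith
    have h2 : b ^ (-α) * P' ≤ 2 * H * ε ^ γ := by
      calc b ^ (-α) * P' ≤ H * b ^ γ := hYle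
        _ ≤ H * (2 * ε) ^ γ := mul_le_mul_of_nonneg_left (Real.rpow_le_rpow hb hb2 hγ.le) hH
        _ = H * (2 ^ γ * ε ^ γ) := by rw [Real.mul_rpow zero_le_two hε.le]
        _ ≤ H * (2 * ε ^ γ) := mul_le_mul_of_nonneg_left (mul_le_mul_of_nonneg_right h2γ hεγ) hH
        _ = 2 * H * ε ^ γ := by ring
    rw [abs_sub_le_iff]
    constructor <;> nlinarith
  · -- FAR case: `ε < a`, hence `0 < a`, `0 < b`
    rw [not_le] at hnear
    have hapos : 0 < a := hε.trans hnear
    have hbpos : 0 < b := by linarith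
    -- piece 1: `a^{-α} |P − P'| ≤ H ε^γ`
    have hεa : ε ^ (-α) * ε ^ s = ε ^ γ := by
      rw [← Real.rpow_add hε]; congr 1; rw [hs_def]; ring
    have haα : a ^ (-α) ≤ ε ^ (-α) := Real.rpow_le_rpow_of_nonpos hε hnear.le (by linarith)
    have piece1 : |a ^ (-α) * (P - P')| ≤ H * ε ^ γ := by
      rw [abs_mul, abs_of_nonneg (Real.rpow_nonneg ha _)]
      calc a ^ (-α) * |P - P'| ≤ ε ^ (-α) * (H * ε ^ s) :=
            mul_le_mul haα hPP (abs_nonneg _) (Real.rpow_nonneg hε.le _)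
        _ = H * (ε ^ (-α) * ε ^ s) := by ring
        _ = H * ε ^ γ := by rw [hεa]
    -- the common tail: `H ε a^{γ-1} ≤ H ε^γ`
    have htail : H * ε * a ^ (γ - 1) ≤ H * ε ^ γ := by
      have h1 : a ^ (γ - 1) ≤ ε ^ (γ - 1) := Real.rpow_le_rpow_of_nonpos hε hnear.le (by linarith)
      have h2 : ε * ε ^ (γ - 1) = ε ^ γ := by
        rw [Real.rpow_sub_one hε.ne']; field_simp
      calc H * ε * a ^ (γ - 1) ≤ H * ε * ε ^ (γ - 1) :=
            mul_le_mul_of_nonneg_left h1 (mul_nonneg hH hε.le)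
        _ = H * (ε * ε ^ (γ - 1)) := by ring
        _ = H * ε ^ γ := by rw [h2]
    -- piece 2: `|a^{-α} − b^{-α}| P' ≤ H ε^γ`
    have piece2 : |(a ^ (-α) - b ^ (-α)) * P'| ≤ H * ε ^ γ := by
      rw [abs_mul, abs_of_nonneg hP'0]
      rcases le_total b a with hba | hab'
      · -- b ≤ a
        have hd : b ^ (-α) - a ^ (-α) ≤ b ^ (-α) * (a - b) / a :=
          prefac hbpos hba
        have hnn : 0 ≤ b ^ (-α) - a ^ (-α) :=
          sub_nonneg.mpr (Real.rpow_le_rpow_of_nonpos hbpos hba (by linarith))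
        rw [abs_sub_comm, abs_of_nonneg hnn]
        have hd2 : b ^ (-α) - a ^ (-α) ≤ b ^ (-α) * ε / a := by
          refine hd.trans ?_
          rw [div_le_div_iff_of_pos_right hapos]
          exact mul_le_mul_of_nonneg_left hab1 (Real.rpow_nonneg hb _)
        have hbγ : b ^ (-α) * b ^ s = b ^ γ := by
          rw [← Real.rpow_add hbpos]; congr 1; rw [hs_def]; ring
        have hbγa : b ^ γ ≤ a ^ γ := Real.rpow_le_rpow hb hba hγ.le
        have haγ : a ^ γ / a = a ^ (γ - 1) := by rw [Real.rpow_sub_one hapos.ne']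
        calc (b ^ (-α) - a ^ (-α)) * P' ≤ (b ^ (-α) * ε / a) * (H * b ^ s) :=
              mul_le_mul hd2 hP' hP'0 (by positivity)
          _ = H * ε * ((b ^ (-α) * b ^ s) / a) := by ring
          _ = H * ε * (b ^ γ / a) := by rw [hbγ]
          _ ≤ H * ε * (a ^ γ / a) := by gcongr
          _ = H * ε * a ^ (γ - 1) := by rw [haγ]
          _ ≤ H * ε ^ γ := htail
      · -- a ≤ b
        have hd : a ^ (-α) - b ^ (-α) ≤ a ^ (-α) * (b - a) / b :=
          prefac hapos hab'
        have hnn : 0 ≤ a ^ (-α) - b ^ (-α) :=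
          sub_nonneg.mpr (Real.rpow_le_rpow_of_nonpos hapos hab' (by linarith))
        rw [abs_of_nonneg hnn]
        have hd2 : a ^ (-α) - b ^ (-α) ≤ a ^ (-α) * ε / b := by
          refine hd.trans ?_
          rw [div_le_div_iff_of_pos_right hbpos]
          exact mul_le_mul_of_nonneg_left hab2 (Real.rpow_nonneg ha _)
        have hbs : b ^ s / b = b ^ (s - 1) := by rw [Real.rpow_sub_one hbpos.ne']
        have hbs2 : b ^ (s - 1) ≤ a ^ (s - 1) :=
          Real.rpow_le_rpow_of_nonpos hapos hab' (by linarith)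
        have has : a ^ (-α) * a ^ (s - 1) = a ^ (γ - 1) := by
          rw [← Real.rpow_add hapos]; congr 1; rw [hs_def]; ring
        calc (a ^ (-α) - b ^ (-α)) * P' ≤ (a ^ (-α) * ε / b) * (H * b ^ s) :=
              mul_le_mul hd2 hP' hP'0 (by positivity)
          _ = H * ε * a ^ (-α) * (b ^ s / b) := by ring
          _ = H * ε * a ^ (-α) * b ^ (s - 1) := by rw [hbs]
          _ ≤ H * ε * a ^ (-α) * a ^ (s - 1) := by gcongr
          _ = H * ε * (a ^ (-α) * a ^ (s - 1)) := by ring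
          _ = H * ε * a ^ (γ - 1) := by rw [has]
          _ ≤ H * ε ^ γ := htail
    have hsplit : a ^ (-α) * P - b ^ (-α) * P'
        = a ^ (-α) * (P - P') + (a ^ (-α) - b ^ (-α)) * P' := by ring
    rw [hsplit]
    calc |a ^ (-α) * (P - P') + (a ^ (-α) - b ^ (-α)) * P'|
        ≤ |a ^ (-α) * (P - P')| + |(a ^ (-α) - b ^ (-α)) * P'| := abs_add_le _ _
      _ ≤ H * ε ^ γ + H * ε ^ γ := add_le_add piece1 piece2
      _ ≤ 3 * H * ε ^ γ := by nlinarith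

/-- **(4.28), MODULI form, in difference variables** (a consequence of the printed complex-difference form, which
is `holder_428c_sub`, v1.3).  For `u, u′ ∈ E` with `‖u − u′‖ ≤ ε` (`ε > 0`), momentum `q ∈ E`, `0 ≤ α`, `0 < γ`,
`α + γ ≤ 1`: `|‖u‖^{−α}‖1 − e^{i⟪q,u⟫}‖ − ‖u′‖^{−α}‖1 − e^{i⟪q,u′⟫}‖| ≤ 6·‖q‖^{α+γ}·ε^γ` — the real core fed
with `H = 2‖q‖^{α+γ}` (the phase's Hölder-(α+γ) data from `norm_one_sub_cexp_inner_le` /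
`norm_cexp_inner_sub_cexp_inner_le`). [cite: King1986, (4.28) p.673] -/
theorem holder_428_sub (q u u' : E) {α γ ε : ℝ} (hα : 0 ≤ α) (hγ : 0 < γ) (hαγ : α + γ ≤ 1)
    (hε : 0 < ε) (hu : ‖u - u'‖ ≤ ε) :
    |‖u‖ ^ (-α) * ‖1 - Complex.exp (I * ((⟪q, u⟫_ℝ : ℝ) : ℂ))‖
        - ‖u'‖ ^ (-α) * ‖1 - Complex.exp (I * ((⟪q, u'⟫_ℝ : ℝ) : ℂ))‖|
      ≤ 6 * ‖q‖ ^ (α + γ) * ε ^ γ := by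
  have hs0 : 0 ≤ α + γ := by linarith
  have hH : 0 ≤ 2 * ‖q‖ ^ (α + γ) := by positivity
  have hab : |‖u‖ - ‖u'‖| ≤ ε := (abs_norm_sub_norm_le u u').trans hu
  have hP : ‖1 - Complex.exp (I * ((⟪q, u⟫_ℝ : ℝ) : ℂ))‖ ≤ 2 * ‖q‖ ^ (α + γ) * ‖u‖ ^ (α + γ) :=
    norm_one_sub_cexp_inner_le q u hs0 hαγ
  have hP' : ‖1 - Complex.exp (I * ((⟪q, u'⟫_ℝ : ℝ) : ℂ))‖ ≤ 2 * ‖q‖ ^ (α + γ) * ‖u'‖ ^ (α + γ) :=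
    norm_one_sub_cexp_inner_le q u' hs0 hαγ
  have hPP : |‖1 - Complex.exp (I * ((⟪q, u⟫_ℝ : ℝ) : ℂ))‖
      - ‖1 - Complex.exp (I * ((⟪q, u'⟫_ℝ : ℝ) : ℂ))‖| ≤ 2 * ‖q‖ ^ (α + γ) * ε ^ (α + γ) := by
    have h1 := abs_norm_sub_norm_le (1 - Complex.exp (I * ((⟪q, u⟫_ℝ : ℝ) : ℂ)))
      (1 - Complex.exp (I * ((⟪q, u'⟫_ℝ : ℝ) : ℂ)))
    have h2 : ‖(1 - Complex.exp (I * ((⟪q, u⟫_ℝ : ℝ) : ℂ)))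
        - (1 - Complex.exp (I * ((⟪q, u'⟫_ℝ : ℝ) : ℂ)))‖
        = ‖Complex.exp (I * ((⟪q, u'⟫_ℝ : ℝ) : ℂ)) - Complex.exp (I * ((⟪q, u⟫_ℝ : ℝ) : ℂ))‖ := by
      congr 1; ring
    have h3 := norm_cexp_inner_sub_cexp_inner_le q u' u hs0 hαγ
    have h4 : ‖u' - u‖ ^ (α + γ) ≤ ε ^ (α + γ) := by
      rw [norm_sub_rev]; exact Real.rpow_le_rpow (norm_nonneg _) hu hs0
    calc |‖1 - Complex.exp (I * ((⟪q, u⟫_ℝ : ℝ) : ℂ))‖ - ‖1 - Complex.exp (I * ((⟪q, u'⟫_ℝ : ℝ) : ℂ))‖|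
        ≤ ‖Complex.exp (I * ((⟪q, u'⟫_ℝ : ℝ) : ℂ)) - Complex.exp (I * ((⟪q, u⟫_ℝ : ℝ) : ℂ))‖ := by
          rw [← h2]; exact h1
      _ ≤ 2 * ‖q‖ ^ (α + γ) * ‖u' - u‖ ^ (α + γ) := h3
      _ ≤ 2 * ‖q‖ ^ (α + γ) * ε ^ (α + γ) := mul_le_mul_of_nonneg_left h4 hH
  have h := holder_428_core hα hγ hαγ hε hH (norm_nonneg u) (norm_nonneg u') hab (norm_nonneg _) hP
    (norm_nonneg _) hP' hPP
  calc _ ≤ 3 * (2 * ‖q‖ ^ (α + γ)) * ε ^ γ := h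
    _ = 6 * ‖q‖ ^ (α + γ) * ε ^ γ := by ring

/-- **(4.28), MODULI form, explicit constant, every point pair** (the difference of the MODULI of the two Hölder
quotients — a CONSEQUENCE of print's complex-difference statement, which is `holder_428c` (v1.3), by
`|‖A‖ − ‖B‖| ≤ ‖A − B‖`; not equivalent to it: cross-read C-ne4p1-39).  In a real inner product space `E`, for sites
with `‖x − x′‖ ≤ δ`, `‖y − y′‖ ≤ δ` (`δ > 0`), momentum `q`, `0 ≤ α`, `0 < γ`, `α + γ ≤ 1`:
`|‖x − y‖^{−α}‖1 − e^{i⟪q, y−x⟫}‖ − ‖x′ − y′‖^{−α}‖1 − e^{i⟪q, y′−x′⟫}‖| ≤ 12·‖q‖^{α+γ}·δ^γ` (`δ = L^{−k}`: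
`holder_428_king`); print's restriction to |x − y| > L^{−k} (its near pairs being (4.26)'s) and its «γ ≤ α» are not
needed, and «α + γ < 1» is relaxed to `≤ 1`. [cite: King1986, (4.28) p.673; (4.27) p.673] -/
theorem holder_428 (q x y x' y' : E) {α γ δ : ℝ} (hα : 0 ≤ α) (hγ : 0 < γ) (hαγ : α + γ ≤ 1)
    (hδ : 0 < δ) (hx : ‖x - x'‖ ≤ δ) (hy : ‖y - y'‖ ≤ δ) :
    |‖x - y‖ ^ (-α) * ‖1 - Complex.exp (I * ((⟪q, y - x⟫_ℝ : ℝ) : ℂ))‖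
        - ‖x' - y'‖ ^ (-α) * ‖1 - Complex.exp (I * ((⟪q, y' - x'⟫_ℝ : ℝ) : ℂ))‖|
      ≤ 12 * ‖q‖ ^ (α + γ) * δ ^ γ := by
  have hγ1 : γ ≤ 1 := by linarith
  have hu : ‖(y - x) - (y' - x')‖ ≤ 2 * δ := by
    have : (y - x) - (y' - x') = (y - y') - (x - x') := by abel
    rw [this]
    calc ‖(y - y') - (x - x')‖ ≤ ‖y - y'‖ + ‖x - x'‖ := norm_sub_le _ _
      _ ≤ δ + δ := add_le_add hy hx
      _ = 2 * δ := by ring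
  have h := holder_428_sub q (y - x) (y' - x') hα hγ hαγ (by positivity) hu
  rw [norm_sub_rev y x, norm_sub_rev y' x'] at h
  have h2δ : (2 * δ) ^ γ ≤ 2 * δ ^ γ := by
    rw [Real.mul_rpow zero_le_two hδ.le]
    have h2 : (2 : ℝ) ^ γ ≤ 2 := by
      have h := Real.rpow_le_rpow_of_exponent_le (by norm_num : (1 : ℝ) ≤ 2) hγ1
      rwa [Real.rpow_one] at h
    exact mul_le_mul_of_nonneg_right h2 (Real.rpow_nonneg hδ.le _)
  have hq : 0 ≤ 6 * ‖q‖ ^ (α + γ) := by positivity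
  calc _ ≤ 6 * ‖q‖ ^ (α + γ) * (2 * δ) ^ γ := h
    _ ≤ 6 * ‖q‖ ^ (α + γ) * (2 * δ ^ γ) := mul_le_mul_of_nonneg_left h2δ hq
    _ = 12 * ‖q‖ ^ (α + γ) * δ ^ γ := by ring

/-- **(4.28), MODULI form, in King's scaling.**  `δ = L^{−k}` (`L ≥ 2`): the difference of the moduli of the two
Hölder quotients is `≤ 12·(L^{−k})^γ·‖q‖^{α+γ}` (`q = p′ + l`); the printed complex-difference form is
`holder_428c_king` (v1.3). [cite: King1986, (4.28) p.673] -/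
theorem holder_428_king (q x y x' y' : E) {L : ℕ} (hL : 2 ≤ L) (k : ℕ) {α γ : ℝ} (hα : 0 ≤ α)
    (hγ : 0 < γ) (hαγ : α + γ ≤ 1) (hx : ‖x - x'‖ ≤ ((L : ℝ) ^ k)⁻¹) (hy : ‖y - y'‖ ≤ ((L : ℝ) ^ k)⁻¹) :
    |‖x - y‖ ^ (-α) * ‖1 - Complex.exp (I * ((⟪q, y - x⟫_ℝ : ℝ) : ℂ))‖
        - ‖x' - y'‖ ^ (-α) * ‖1 - Complex.exp (I * ((⟪q, y' - x'⟫_ℝ : ℝ) : ℂ))‖|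
      ≤ 12 * (((L : ℝ) ^ k)⁻¹) ^ γ * ‖q‖ ^ (α + γ) := by
  have hL1 : (0 : ℝ) < L := by exact_mod_cast Nat.lt_of_lt_of_le Nat.zero_lt_two hL
  have hδ : 0 < ((L : ℝ) ^ k)⁻¹ := inv_pos.mpr (pow_pos hL1 k)
  have h := holder_428 q x y x' y' hα hγ hαγ hδ hx hy
  calc _ ≤ 12 * ‖q‖ ^ (α + γ) * (((L : ℝ) ^ k)⁻¹) ^ γ := h
    _ = 12 * (((L : ℝ) ^ k)⁻¹) ^ γ * ‖q‖ ^ (α + γ) := by ring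

/-- **(4.28), MODULI form, in the scalar currency of `holder_426`** (`E = ℝ`: `⟪q, u⟫ = q·u`, `‖u‖ = |u|`): for real
`q, x, y, x′, y′` with `|x − x′| ≤ δ`, `|y − y′| ≤ δ`:
`||x − y|^{−α}‖1 − e^{iq(y−x)}‖ − |x′ − y′|^{−α}‖1 − e^{iq(y′−x′)}‖| ≤ 12·|q|^{α+γ}·δ^γ`; the printed
complex-difference form is `holder_428c_real` (v1.3). [cite: King1986, (4.28) p.673] -/
theorem holder_428_real (q x y x' y' : ℝ) {α γ δ : ℝ} (hα : 0 ≤ α) (hγ : 0 < γ) (hαγ : α + γ ≤ 1)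
    (hδ : 0 < δ) (hx : |x - x'| ≤ δ) (hy : |y - y'| ≤ δ) :
    |(|x - y| ^ (-α) * ‖1 - Complex.exp (I * ((q * (y - x) : ℝ) : ℂ))‖)
        - (|x' - y'| ^ (-α) * ‖1 - Complex.exp (I * ((q * (y' - x') : ℝ) : ℂ))‖)|
      ≤ 12 * |q| ^ (α + γ) * δ ^ γ := by
  have h := holder_428 q x y x' y' hα hγ hαγ hδ (by rwa [Real.norm_eq_abs]) (by rwa [Real.norm_eq_abs])
  have e1 : ⟪q, y - x⟫_ℝ = q * (y - x) := by simp [mul_comm]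
  have e2 : ⟪q, y' - x'⟫_ℝ = q * (y' - x') := by simp [mul_comm]
  rw [e1, e2, Real.norm_eq_abs, Real.norm_eq_abs, Real.norm_eq_abs] at h
  exact h


/-! ## §8b (v1.3) (4.28) AS PRINTED — the modulus of the COMPLEX difference

XREAD C-ne4p1-39 (t4-ne4-p1-g19, on v1.2) located a statement-shape gap in §8: print's (4.28) bounds the modulus of
the DIFFERENCE OF THE TWO COMPLEX NUMBERS `|x − y|^{−α}{1 − exp[i(p′+l)(y − x)]}` and `|x′ − y′|^{−α}{1 − exp[i(p′+l)
(y′ − x′)]}` (the braces are grouping, as in (4.26); it is the form that Prop. 3.8's factor-by-factor replacement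
consumes, p. 664), whereas v1.2's `holder_428*` bound the difference of their MODULI — a consequence of the printed
statement (`|‖A‖ − ‖B‖| ≤ ‖A − B‖`), not conversely (witness `x′ = y`, `y′ = x`, `‖x − y‖ ≤ δ`: moduli difference
`0`, complex difference `2‖x − y‖^{−α}|sin⟪q, y − x⟫|`).  This section proves the PRINTED shape with the SAME
constants by the SAME near/far arithmetic, run in a normed space instead of `ℝ`: `holder_428c_core` (any real normed
space `V`, scalars `a^{−α} • P`), `holder_428c_sub` (constant `6`), `holder_428c` (constant `12`), `holder_428c_king`,
`holder_428c_real`.  The v1.2 statements stay as they are (byte-identical declarations; their docstrings now say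
"moduli form"). -/

/-- **The normed core of (4.28).**  `V` a real normed space; distances `a, b ≥ 0` with `|a − b| ≤ ε`; vectors
`P, P′ ∈ V` with `‖P‖ ≤ H·a^{α+γ}`, `‖P′‖ ≤ H·b^{α+γ}`, `‖P − P′‖ ≤ H·ε^{α+γ}` (`H ≥ 0`, `0 ≤ α`, `0 < γ`,
`α + γ ≤ 1`, `ε > 0`): `‖a^{−α}•P − b^{−α}•P′‖ ≤ 3·H·ε^γ`.  NEAR (`a ≤ ε`): the two norms separately, `H·ε^γ +
2H·ε^γ`.  FAR (`a > ε`): `a^{−α}•P − b^{−α}•P′ = a^{−α}•(P − P′) + (a^{−α} − b^{−α})•P′`, pieces `≤ H·ε^γ` each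
(the prefactor's increment `b^{−α} − a^{−α} ≤ b^{−α}(a − b)/a` for `0 < b ≤ a` as a local step, = the tree's
`B5Hk163RateQuotient.rpow_neg_sub_rpow_neg_le`).  `holder_428_core` (v1.2) is the case `V = ℝ`, `P, P′ ≥ 0` up to
`|·|` versus `‖·‖`. [folklore] -/
theorem holder_428c_core {V : Type*} [SeminormedAddCommGroup V] [NormedSpace ℝ V]
    {a b H ε α γ : ℝ} {P P' : V} (hα : 0 ≤ α) (hγ : 0 < γ) (hαγ : α + γ ≤ 1)
    (hε : 0 < ε) (hH : 0 ≤ H) (ha : 0 ≤ a) (hb : 0 ≤ b) (hab : |a - b| ≤ ε)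
    (hP : ‖P‖ ≤ H * a ^ (α + γ)) (hP' : ‖P'‖ ≤ H * b ^ (α + γ))
    (hPP : ‖P - P'‖ ≤ H * ε ^ (α + γ)) :
    ‖a ^ (-α) • P - b ^ (-α) • P'‖ ≤ 3 * H * ε ^ γ := by
  set s := α + γ with hs_def
  have hs0 : 0 < s := by rw [hs_def]; linarith
  have hγ1 : γ ≤ 1 := by linarith
  have hεγ : 0 ≤ ε ^ γ := Real.rpow_nonneg hε.le _
  have hab1 : a - b ≤ ε := (le_abs_self _).trans hab
  have hab2 : b - a ≤ ε := by rw [abs_sub_comm] at hab; exact (le_abs_self _).trans hab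
  have hP0 : 0 ≤ ‖P‖ := norm_nonneg _
  have hP'0 : 0 ≤ ‖P'‖ := norm_nonneg _
  have prefac : ∀ {a' b' : ℝ}, 0 < b' → b' ≤ a' → b' ^ (-α) - a' ^ (-α) ≤ b' ^ (-α) * (a' - b') / a' := by
    intro a' b' hb' hba'
    have ha' : 0 < a' := hb'.trans_le hba'
    have ht0 : 0 < b' / a' := div_pos hb' ha'
    have ht1 : b' / a' ≤ 1 := (div_le_one ha').mpr hba'
    have hkey : a' ^ (-α) = b' ^ (-α) * (b' / a') ^ α := by
      rw [Real.div_rpow hb'.le ha'.le, Real.rpow_neg hb'.le, Real.rpow_neg ha'.le]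
      have hbα : b' ^ α ≠ 0 := (Real.rpow_pos_of_pos hb' α).ne'
      field_simp
    have hmono : b' / a' ≤ (b' / a') ^ α := by
      have h := Real.rpow_le_rpow_of_exponent_ge ht0 ht1 (by linarith : α ≤ 1)
      rwa [Real.rpow_one] at h
    have hb0 : 0 ≤ b' ^ (-α) := Real.rpow_nonneg hb'.le _
    rw [hkey]
    calc b' ^ (-α) - b' ^ (-α) * (b' / a') ^ α = b' ^ (-α) * (1 - (b' / a') ^ α) := by ring
      _ ≤ b' ^ (-α) * (1 - b' / a') := mul_le_mul_of_nonneg_left (by linarith) hb0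
      _ = b' ^ (-α) * (a' - b') / a' := by field_simp
  have key : ∀ {t R : ℝ}, 0 ≤ t → 0 ≤ R → R ≤ H * t ^ s → t ^ (-α) * R ≤ H * t ^ γ := by
    intro t R ht hR hRle
    rcases ht.eq_or_lt with h0 | htpos
    · rw [← h0] at hRle ⊢
      rw [Real.zero_rpow hs0.ne', mul_zero] at hRle
      have hR0 : R = 0 := le_antisymm hRle hR
      rw [hR0, mul_zero, Real.zero_rpow hγ.ne', mul_zero]
    · calc t ^ (-α) * R ≤ t ^ (-α) * (H * t ^ s) :=
            mul_le_mul_of_nonneg_left hRle (Real.rpow_nonneg ht _)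
        _ = H * (t ^ (-α) * t ^ s) := by ring
        _ = H * t ^ γ := by rw [← Real.rpow_add htpos]; congr 1; rw [hs_def]; ring_nf
  have hna : ‖a ^ (-α) • P‖ = a ^ (-α) * ‖P‖ := by
    rw [norm_smul, Real.norm_eq_abs, abs_of_nonneg (Real.rpow_nonneg ha _)]
  have hnb : ‖b ^ (-α) • P'‖ = b ^ (-α) * ‖P'‖ := by
    rw [norm_smul, Real.norm_eq_abs, abs_of_nonneg (Real.rpow_nonneg hb _)]
  have hXle : a ^ (-α) * ‖P‖ ≤ H * a ^ γ := key ha hP0 hP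
  have hYle : b ^ (-α) * ‖P'‖ ≤ H * b ^ γ := key hb hP'0 hP'
  have h2γ : (2 : ℝ) ^ γ ≤ 2 := by
    have h := Real.rpow_le_rpow_of_exponent_le (by norm_num : (1 : ℝ) ≤ 2) hγ1
    rwa [Real.rpow_one] at h
  by_cases hnear : a ≤ ε
  · have h1 : a ^ (-α) * ‖P‖ ≤ H * ε ^ γ :=
      hXle.trans (mul_le_mul_of_nonneg_left (Real.rpow_le_rpow ha hnear hγ.le) hH)
    have hb2 : b ≤ 2 * ε := by linarith
    have h2 : b ^ (-α) * ‖P'‖ ≤ 2 * H * ε ^ γ := by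
      calc b ^ (-α) * ‖P'‖ ≤ H * b ^ γ := hYle
        _ ≤ H * (2 * ε) ^ γ := mul_le_mul_of_nonneg_left (Real.rpow_le_rpow hb hb2 hγ.le) hH
        _ = H * (2 ^ γ * ε ^ γ) := by rw [Real.mul_rpow zero_le_two hε.le]
        _ ≤ H * (2 * ε ^ γ) := mul_le_mul_of_nonneg_left (mul_le_mul_of_nonneg_right h2γ hεγ) hH
        _ = 2 * H * ε ^ γ := by ring
    calc ‖a ^ (-α) • P - b ^ (-α) • P'‖ ≤ ‖a ^ (-α) • P‖ + ‖b ^ (-α) • P'‖ := norm_sub_le _ _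
      _ = a ^ (-α) * ‖P‖ + b ^ (-α) * ‖P'‖ := by rw [hna, hnb]
      _ ≤ H * ε ^ γ + 2 * H * ε ^ γ := add_le_add h1 h2
      _ = 3 * H * ε ^ γ := by ring
  · rw [not_le] at hnear
    have hapos : 0 < a := hε.trans hnear
    have hbpos : 0 < b := by linarith
    have hεa : ε ^ (-α) * ε ^ s = ε ^ γ := by
      rw [← Real.rpow_add hε]; congr 1; rw [hs_def]; ring
    have haα : a ^ (-α) ≤ ε ^ (-α) := Real.rpow_le_rpow_of_nonpos hε hnear.le (by linarith)
    have piece1 : ‖a ^ (-α) • (P - P')‖ ≤ H * ε ^ γ := by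
      rw [norm_smul, Real.norm_eq_abs, abs_of_nonneg (Real.rpow_nonneg ha _)]
      calc a ^ (-α) * ‖P - P'‖ ≤ ε ^ (-α) * (H * ε ^ s) :=
            mul_le_mul haα hPP (norm_nonneg _) (Real.rpow_nonneg hε.le _)
        _ = H * (ε ^ (-α) * ε ^ s) := by ring
        _ = H * ε ^ γ := by rw [hεa]
    have htail : H * ε * a ^ (γ - 1) ≤ H * ε ^ γ := by
      have h1 : a ^ (γ - 1) ≤ ε ^ (γ - 1) := Real.rpow_le_rpow_of_nonpos hε hnear.le (by linarith)
      have h2 : ε * ε ^ (γ - 1) = ε ^ γ := by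
        rw [Real.rpow_sub_one hε.ne']; field_simp
      calc H * ε * a ^ (γ - 1) ≤ H * ε * ε ^ (γ - 1) :=
            mul_le_mul_of_nonneg_left h1 (mul_nonneg hH hε.le)
        _ = H * (ε * ε ^ (γ - 1)) := by ring
        _ = H * ε ^ γ := by rw [h2]
    have piece2 : ‖(a ^ (-α) - b ^ (-α)) • P'‖ ≤ H * ε ^ γ := by
      rw [norm_smul, Real.norm_eq_abs]
      rcases le_total b a with hba | hab'
      · have hd : b ^ (-α) - a ^ (-α) ≤ b ^ (-α) * (a - b) / a := prefac hbpos hba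
        have hnn : 0 ≤ b ^ (-α) - a ^ (-α) :=
          sub_nonneg.mpr (Real.rpow_le_rpow_of_nonpos hbpos hba (by linarith))
        rw [abs_sub_comm, abs_of_nonneg hnn]
        have hd2 : b ^ (-α) - a ^ (-α) ≤ b ^ (-α) * ε / a := by
          refine hd.trans ?_
          rw [div_le_div_iff_of_pos_right hapos]
          exact mul_le_mul_of_nonneg_left hab1 (Real.rpow_nonneg hb _)
        have hbγ : b ^ (-α) * b ^ s = b ^ γ := by
          rw [← Real.rpow_add hbpos]; congr 1; rw [hs_def]; ring
        have hbγa : b ^ γ ≤ a ^ γ := Real.rpow_le_rpow hb hba hγ.le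
        have haγ : a ^ γ / a = a ^ (γ - 1) := by rw [Real.rpow_sub_one hapos.ne']
        calc (b ^ (-α) - a ^ (-α)) * ‖P'‖ ≤ (b ^ (-α) * ε / a) * (H * b ^ s) :=
              mul_le_mul hd2 hP' hP'0 (by positivity)
          _ = H * ε * ((b ^ (-α) * b ^ s) / a) := by ring
          _ = H * ε * (b ^ γ / a) := by rw [hbγ]
          _ ≤ H * ε * (a ^ γ / a) := by gcongr
          _ = H * ε * a ^ (γ - 1) := by rw [haγ]
          _ ≤ H * ε ^ γ := htail
      · have hd : a ^ (-α) - b ^ (-α) ≤ a ^ (-α) * (b - a) / b := prefac hapos hab'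
        have hnn : 0 ≤ a ^ (-α) - b ^ (-α) :=
          sub_nonneg.mpr (Real.rpow_le_rpow_of_nonpos hapos hab' (by linarith))
        rw [abs_of_nonneg hnn]
        have hd2 : a ^ (-α) - b ^ (-α) ≤ a ^ (-α) * ε / b := by
          refine hd.trans ?_
          rw [div_le_div_iff_of_pos_right hbpos]
          exact mul_le_mul_of_nonneg_left hab2 (Real.rpow_nonneg ha _)
        have hbs : b ^ s / b = b ^ (s - 1) := by rw [Real.rpow_sub_one hbpos.ne']
        have hbs2 : b ^ (s - 1) ≤ a ^ (s - 1) :=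
          Real.rpow_le_rpow_of_nonpos hapos hab' (by linarith)
        have has : a ^ (-α) * a ^ (s - 1) = a ^ (γ - 1) := by
          rw [← Real.rpow_add hapos]; congr 1; rw [hs_def]; ring
        calc (a ^ (-α) - b ^ (-α)) * ‖P'‖ ≤ (a ^ (-α) * ε / b) * (H * b ^ s) :=
              mul_le_mul hd2 hP' hP'0 (by positivity)
          _ = H * ε * a ^ (-α) * (b ^ s / b) := by ring
          _ = H * ε * a ^ (-α) * b ^ (s - 1) := by rw [hbs]
          _ ≤ H * ε * a ^ (-α) * a ^ (s - 1) := by gcongr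
          _ = H * ε * (a ^ (-α) * a ^ (s - 1)) := by ring
          _ = H * ε * a ^ (γ - 1) := by rw [has]
          _ ≤ H * ε ^ γ := htail
    have hsplit : a ^ (-α) • P - b ^ (-α) • P'
        = a ^ (-α) • (P - P') + (a ^ (-α) - b ^ (-α)) • P' := by
      rw [smul_sub, sub_smul]; abel
    rw [hsplit]
    calc ‖a ^ (-α) • (P - P') + (a ^ (-α) - b ^ (-α)) • P'‖
        ≤ ‖a ^ (-α) • (P - P')‖ + ‖(a ^ (-α) - b ^ (-α)) • P'‖ := norm_add_le _ _
      _ ≤ H * ε ^ γ + H * ε ^ γ := add_le_add piece1 piece2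
      _ ≤ 3 * H * ε ^ γ := by nlinarith

/-- **(4.28) AS PRINTED, difference variables.**  For `u, u′ ∈ E` with `‖u − u′‖ ≤ ε` (`ε > 0`), momentum `q ∈ E`,
`0 ≤ α`, `0 < γ`, `α + γ ≤ 1`:
`‖ ‖u‖^{−α}·(1 − e^{i⟪q,u⟫}) − ‖u′‖^{−α}·(1 − e^{i⟪q,u′⟫}) ‖ ≤ 6·‖q‖^{α+γ}·ε^γ` (complex difference; the real
prefactors coerced to `ℂ`) — `holder_428c_core` at `V = ℂ` with `H = 2‖q‖^{α+γ}`. [cite: King1986, (4.28) p.673] -/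
theorem holder_428c_sub (q u u' : E) {α γ ε : ℝ} (hα : 0 ≤ α) (hγ : 0 < γ) (hαγ : α + γ ≤ 1)
    (hε : 0 < ε) (hu : ‖u - u'‖ ≤ ε) :
    ‖((‖u‖ ^ (-α) : ℝ) : ℂ) * (1 - Complex.exp (I * ((⟪q, u⟫_ℝ : ℝ) : ℂ)))
        - ((‖u'‖ ^ (-α) : ℝ) : ℂ) * (1 - Complex.exp (I * ((⟪q, u'⟫_ℝ : ℝ) : ℂ)))‖
      ≤ 6 * ‖q‖ ^ (α + γ) * ε ^ γ := by
  have hs0 : 0 ≤ α + γ := by linarith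
  have hH : 0 ≤ 2 * ‖q‖ ^ (α + γ) := by positivity
  have hab : |‖u‖ - ‖u'‖| ≤ ε := (abs_norm_sub_norm_le u u').trans hu
  have hP : ‖1 - Complex.exp (I * ((⟪q, u⟫_ℝ : ℝ) : ℂ))‖ ≤ 2 * ‖q‖ ^ (α + γ) * ‖u‖ ^ (α + γ) :=
    norm_one_sub_cexp_inner_le q u hs0 hαγ
  have hP' : ‖1 - Complex.exp (I * ((⟪q, u'⟫_ℝ : ℝ) : ℂ))‖ ≤ 2 * ‖q‖ ^ (α + γ) * ‖u'‖ ^ (α + γ) :=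
    norm_one_sub_cexp_inner_le q u' hs0 hαγ
  have hPP : ‖(1 - Complex.exp (I * ((⟪q, u⟫_ℝ : ℝ) : ℂ)))
      - (1 - Complex.exp (I * ((⟪q, u'⟫_ℝ : ℝ) : ℂ)))‖ ≤ 2 * ‖q‖ ^ (α + γ) * ε ^ (α + γ) := by
    have h2 : (1 - Complex.exp (I * ((⟪q, u⟫_ℝ : ℝ) : ℂ)))
        - (1 - Complex.exp (I * ((⟪q, u'⟫_ℝ : ℝ) : ℂ)))
        = Complex.exp (I * ((⟪q, u'⟫_ℝ : ℝ) : ℂ)) - Complex.exp (I * ((⟪q, u⟫_ℝ : ℝ) : ℂ)) := by ring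
    have h3 := norm_cexp_inner_sub_cexp_inner_le q u' u hs0 hαγ
    have h4 : ‖u' - u‖ ^ (α + γ) ≤ ε ^ (α + γ) := by
      rw [norm_sub_rev]; exact Real.rpow_le_rpow (norm_nonneg _) hu hs0
    rw [h2]
    exact h3.trans (mul_le_mul_of_nonneg_left h4 hH)
  have h := holder_428c_core (V := ℂ) hα hγ hαγ hε hH (norm_nonneg u) (norm_nonneg u') hab hP hP' hPP
  rw [Complex.real_smul, Complex.real_smul] at h
  calc _ ≤ 3 * (2 * ‖q‖ ^ (α + γ)) * ε ^ γ := h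
    _ = 6 * ‖q‖ ^ (α + γ) * ε ^ γ := by ring

/-- **(4.28) AS PRINTED, every point pair, explicit constant.**  In a real inner product space `E`, for sites with
`‖x − x′‖ ≤ δ`, `‖y − y′‖ ≤ δ` (`δ > 0`), momentum `q`, `0 ≤ α`, `0 < γ`, `α + γ ≤ 1`:
`‖ ‖x − y‖^{−α}·{1 − e^{i⟪q, y−x⟫}} − ‖x′ − y′‖^{−α}·{1 − e^{i⟪q, y′−x′⟫}} ‖ ≤ 12·‖q‖^{α+γ}·δ^γ` — King's
«||x − y|^{−α}{1 − exp[i(p′+l)(y − x)]} − |x′ − y′|^{−α}{1 − exp[i(p′+l)(y′ − x′)]}| ≤ CL^{−γk}|p′+l|^{α+γ}» with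
`C = 12` at `δ = L^{−k}` (`holder_428c_king`).  Deviations from print, all declared: every point pair (print: |x − y|
> L^{−k}, its near pairs being (4.26)'s), no «γ ≤ α», «α + γ < 1» relaxed to `≤ 1`.  The moduli form `holder_428`
(v1.2) follows from this by `|‖A‖ − ‖B‖| ≤ ‖A − B‖`. [cite: King1986, (4.28) p.673; (4.27) p.673] -/
theorem holder_428c (q x y x' y' : E) {α γ δ : ℝ} (hα : 0 ≤ α) (hγ : 0 < γ) (hαγ : α + γ ≤ 1)
    (hδ : 0 < δ) (hx : ‖x - x'‖ ≤ δ) (hy : ‖y - y'‖ ≤ δ) :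
    ‖((‖x - y‖ ^ (-α) : ℝ) : ℂ) * (1 - Complex.exp (I * ((⟪q, y - x⟫_ℝ : ℝ) : ℂ)))
        - ((‖x' - y'‖ ^ (-α) : ℝ) : ℂ) * (1 - Complex.exp (I * ((⟪q, y' - x'⟫_ℝ : ℝ) : ℂ)))‖
      ≤ 12 * ‖q‖ ^ (α + γ) * δ ^ γ := by
  have hγ1 : γ ≤ 1 := by linarith
  have hu : ‖(y - x) - (y' - x')‖ ≤ 2 * δ := by
    have : (y - x) - (y' - x') = (y - y') - (x - x') := by abel
    rw [this]
    calc ‖(y - y') - (x - x')‖ ≤ ‖y - y'‖ + ‖x - x'‖ := norm_sub_le _ _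
      _ ≤ δ + δ := add_le_add hy hx
      _ = 2 * δ := by ring
  have h := holder_428c_sub q (y - x) (y' - x') hα hγ hαγ (by positivity) hu
  rw [norm_sub_rev y x, norm_sub_rev y' x'] at h
  have h2δ : (2 * δ) ^ γ ≤ 2 * δ ^ γ := by
    rw [Real.mul_rpow zero_le_two hδ.le]
    have h2 : (2 : ℝ) ^ γ ≤ 2 := by
      have h := Real.rpow_le_rpow_of_exponent_le (by norm_num : (1 : ℝ) ≤ 2) hγ1
      rwa [Real.rpow_one] at h
    exact mul_le_mul_of_nonneg_right h2 (Real.rpow_nonneg hδ.le _)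
  have hq : 0 ≤ 6 * ‖q‖ ^ (α + γ) := by positivity
  calc _ ≤ 6 * ‖q‖ ^ (α + γ) * (2 * δ) ^ γ := h
    _ ≤ 6 * ‖q‖ ^ (α + γ) * (2 * δ ^ γ) := mul_le_mul_of_nonneg_left h2δ hq
    _ = 12 * ‖q‖ ^ (α + γ) * δ ^ γ := by ring

/-- **(4.28) AS PRINTED in King's scaling.**  `δ = L^{−k}` (`L ≥ 2`): `≤ 12·(L^{−k})^γ·‖q‖^{α+γ}` — «≤ CL^{−γk}
|p′+l|^{α+γ}» with `C = 12`, `q = p′ + l`. [cite: King1986, (4.28) p.673] -/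
theorem holder_428c_king (q x y x' y' : E) {L : ℕ} (hL : 2 ≤ L) (k : ℕ) {α γ : ℝ} (hα : 0 ≤ α)
    (hγ : 0 < γ) (hαγ : α + γ ≤ 1) (hx : ‖x - x'‖ ≤ ((L : ℝ) ^ k)⁻¹) (hy : ‖y - y'‖ ≤ ((L : ℝ) ^ k)⁻¹) :
    ‖((‖x - y‖ ^ (-α) : ℝ) : ℂ) * (1 - Complex.exp (I * ((⟪q, y - x⟫_ℝ : ℝ) : ℂ)))
        - ((‖x' - y'‖ ^ (-α) : ℝ) : ℂ) * (1 - Complex.exp (I * ((⟪q, y' - x'⟫_ℝ : ℝ) : ℂ)))‖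
      ≤ 12 * (((L : ℝ) ^ k)⁻¹) ^ γ * ‖q‖ ^ (α + γ) := by
  have hL1 : (0 : ℝ) < L := by exact_mod_cast Nat.lt_of_lt_of_le Nat.zero_lt_two hL
  have hδ : 0 < ((L : ℝ) ^ k)⁻¹ := inv_pos.mpr (pow_pos hL1 k)
  have h := holder_428c q x y x' y' hα hγ hαγ hδ hx hy
  calc _ ≤ 12 * ‖q‖ ^ (α + γ) * (((L : ℝ) ^ k)⁻¹) ^ γ := h
    _ = 12 * (((L : ℝ) ^ k)⁻¹) ^ γ * ‖q‖ ^ (α + γ) := by ring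

/-- **(4.28) AS PRINTED in the scalar currency of `holder_426`** (`E = ℝ`: `⟪q, u⟫ = q·u`, `‖u‖ = |u|`).
[cite: King1986, (4.28) p.673] -/
theorem holder_428c_real (q x y x' y' : ℝ) {α γ δ : ℝ} (hα : 0 ≤ α) (hγ : 0 < γ) (hαγ : α + γ ≤ 1)
    (hδ : 0 < δ) (hx : |x - x'| ≤ δ) (hy : |y - y'| ≤ δ) :
    ‖((|x - y| ^ (-α) : ℝ) : ℂ) * (1 - Complex.exp (I * ((q * (y - x) : ℝ) : ℂ)))
        - ((|x' - y'| ^ (-α) : ℝ) : ℂ) * (1 - Complex.exp (I * ((q * (y' - x') : ℝ) : ℂ)))‖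
      ≤ 12 * |q| ^ (α + γ) * δ ^ γ := by
  have h := holder_428c q x y x' y' hα hγ hαγ hδ (by rwa [Real.norm_eq_abs]) (by rwa [Real.norm_eq_abs])
  have e1 : ⟪q, y - x⟫_ℝ = q * (y - x) := by simp [mul_comm]
  have e2 : ⟪q, y' - x'⟫_ℝ = q * (y' - x') := by simp [mul_comm]
  rw [e1, e2, Real.norm_eq_abs, Real.norm_eq_abs, Real.norm_eq_abs] at h
  exact h

end Literature.MathematicalPhysics.QuantumFieldTheory.King1986

end
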